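import Summits.MatrixMultiplication.MatrixMultiplication.Theses.LevelGradedCohnUmans
import Summits.MatrixMultiplication.MatrixMultiplication.Cruxes.LieRankDesigns.Disproof
import Literature.Barriers.MatrixMultiplication.NormalizerBarrier

/-!
# Disproof work file for the crux `LevelOneGL2Designs` (stmt-MatrixMultiplication-14080)

Standing adversary file (cdisprove seat `refuter-cdisprove-stmt-MatrixMultiplication-14080-0`,
route `LevelGradedCohnUmans`, rank-7 crux "universality of the smallest Lie cell").  Prose lives in
docstrings; every `theorem` is kernel-checked (rc 0, no `sorry`) unless it sits in `NearMisses`.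
Vocabulary (`GLm p 2`, `Mat p 2`, `RankSep 1`, `RankLE p 2 1`, walls, graded Neumann, TPP) is
IMPORTED from the sibling seat's `Cruxes/LieRankDesigns/Disproof.lean` (crux 7614), so nothing here
re-derives what is already checked there; `levelOneGL2Designs_iff` pins the crux to it by `Iff.rfl`.

## The statement
`∃ c > 0, ∀ p₀, ∃ prime p ≥ p₀, ∃ X Y Z ⊆ GL_2(𝔽_p)` rank-1-separated with `|X|, |Y|, |Z| ≥ c·p^{3/2}`.
Audit: elaborates (rc 0); no junk corner (the sets are forced non-empty, `p` prime so `ZMod p` is a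
field and `(p:ℝ)^{3/2}` is an honest `rpow`; `m = 2, k = 1` fixed).  The quantifier shape
`∃ c ∀ p₀ ∃ p` makes the crux UNDECIDABLE BY FINITE COMPUTATION: no `decide`/kit job refutes it; a
kill is a packing THEOREM for all large `p`.

## Verdict so far — no kill; why it resists
A refutation is exactly a new level-one packing theorem for `GL_2(𝔽_p)`:
`rank-1-separated ⇒ min(|X|,|Y|,|Z|) = o(p^{3/2})` (e.g. `V := |X||Y||Z| ≤ C·p⁴ = C·|G|^{1+o(1)}`,
`not_levelOneGL2Designs_of_packingBound`).  Nothing of the kind is in print or in the tree: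
* COUNTING is exhausted at the right order: the exact support count `N₁(p) = p³ + p² − p`
  (`card_rankLE_two_one`) turns the sibling's walls / graded Neumann count into
  `|X||Z| + |X|(|Y|−1) ≤ p³ + p² − p`, which caps the constant (`c ≤ 1/√2`,
  `not_levelOneGL2DesignsConst`) and the exponent (`3/2` cannot be raised,
  `not_levelOneGL2DesignsExp`) but leaves the window `c ∈ (0, 1/√2]` open — the crux sits exactly
  at the wall scale `V ≈ W^{3/2}`, `W = dim F_1|_G = p³ + p² − 3p − 1`.
* TENSOR MONOTONES cannot kill it: a witness family is an honest restriction
  `⟨cp^{3/2}, cp^{3/2}, cp^{3/2}⟩ ≤ ℂ ⊕ M_p ⊕ (p−2)·M_{p+1}` (GradedPricing's mechanism); every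
  spectral point / flattening / slice-rank-type monotone is normalised by `d²` on `⟨d,d,d⟩` and only
  reproduces the wall `n² ≤ Σ d²`; a monotone separating the two sides would be a super-quadratic
  rank lower bound for `⟨n,n,n⟩` (unknown beyond `3n² − o(n²)`), and a polynomial one would
  contradict `ω = 2` itself.  So any disproof must use the GROUP structure (how the restriction maps
  factor through permutation matrices of `GL_2(𝔽_p)` on `𝔽_p² ∖ 0`).
* QUASIRANDOM MIXING (BCGPU2023 Thm 3.2, `BCGPU2023_thm32_holds` in tree) caps TPP triples of
  `GL_2(𝔽_p)` at `|G|^{3/2}/√(p−1) ≈ p^{5.5} ≫ p^{4.5}`, BUT it kills CONFINED designs (paper; the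
  character tables are not in the tree): all three sets inside ONE Borel `B` ⇒ `n(B) = p − 1`
  (Clifford: `T` is transitive on `Û∖1`) ⇒ `V ≤ |B|^{3/2}/√(p−1) + |B| ≈ 2p⁴` — so ideator 1's B4
  ("inside one Borel … no barrier applies, treat as famous-scale") is too pessimistic: one-Borel
  witnesses are DEAD; all three sets inside cosets of `SL_2(𝔽_p)` (one det-class each, after the
  free right translations) ⇒ `n = (p−1)/2` ⇒ `V ≤ √2·p⁴` (ideator 2's C4 / ideator 3's N3); more
  generally the det-quotients must generate a subgroup of `𝔽_p^×` of order `≳ c²p^{1/3}`.  The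
  named candidate kill for UNCONFINED designs, a GRADED mixing lemma
  `V ≲ W^{3/2}/√d_min ≈ p⁴`, has no proof idea yet: the trivial character's main term, which drives
  Gowers/BNP mixing, is absent from the graded count, and the coherence of group elements in
  `A_1 = ℂ[G]/F_1^⊥` is only `e_R(g)/e_R(1) ≤ ~1/p` (attained on elements fixing a non-zero
  vector), too weak for a `√p` gain by Gram/Welch-type arguments at `|X||Z| ≈ W`.
* OBSTRUCTION STRUCTURE (paper): `F_1^⊥` = functions with zero sum on every left coset of every
  vector stabiliser `S_u` (`u ∈ P¹`, blocks of size `p(p−1)`); its smallest elements are "toral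
  `2×2` rectangles of `U`-cosets inside a Borel coset" (support `4p`), and separation at a target `t`
  fails iff some `h ∈ F_1^⊥` supported in `P = X⁻¹YY⁻¹Z` has `h(t) ≠ 0`.  Cheap protection
  (`P ∩ tS_u = {t}` for some `u`) forces `P` to miss a whole punctured stabiliser coset (`≈ p²`
  elements with eigenvalue pattern fixed) near every one of the `c²p³` targets — strong structure,
  but not a contradiction.
* CONSTRUCTIONS all stall at `V ≈ p⁴ = |G|`: parabolic/Borel triples (`(Aff⁺,T,U⁻)`: TPP, `V =
  p²(p−1)²`, NOT rank-1-separated by kit j008119), thinned Borels `U⋊A` with `|A| ≈ √p` against a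
  non-split-torus middle (`Q(Y)` must dodge `XZ`, density `1/p`, greedy `|Y| ≈ p/2`), `(S₁U⁻,1,U⁺)`
  (separated, `|Y| = 1`).  The crux asks for `|G|^{9/8}`, above every PRIME-field TPP construction
  known (CU2003 Prop 11's `|G|^{7/6}` needs `𝔽_{q²}`).
* PERMUTABLE SUBGROUP DESIGNS NEVER EXCEED THE WALL (new theorem, any finite group, any
  bi-invariant `J`; `card_mul_card_mul_card_le_finrank_of_permutable`): if `H₁H₂ = H₂H₁` and the
  subgroup triple passes TPP + the identity test, then `|H₁||H₂||H₃| ≤ dim J` (translate the test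
  function by `((ab)⁻¹, c⁻¹)`, which preserves `S = H₁H₂H₃` because `H₁H₂` is a group, so `S` is a
  `J`-interpolation set; permutability also makes the triple product injective, which TPP alone
  does not — `S₃` with its three subgroups of order `2` has the TPP and `V = 8 > 6 = |G|`, so the
  route text's "subgroup designs impossible at `m = 2` (`V ≤ |G|`)" was unfounded as stated).  At
  level one this gives `V ≤ N₁(p) ≈ p³` for every such template (`volume_le_of_permutable_subgroups`):
  `(U⁻,T,U⁺)` (`V = p²(p−1)²`) is therefore NOT rank-1-separated for any `p ≥ 3` (kit j008501's
  question, settled on paper and in Lean), `(Aff⁺,T,U⁻)` likewise (consistent with kit j008119),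
  every `(U⁻⋊A₁, T', U⁺⋊A₃)` with a split-torus middle is capped at the wall, and the crux restricted
  to permutable subgroup triples is FALSE (`not_levelOneGL2Designs_permutableSubgroups`).  The ONLY
  subgroup shape left at `(2,1)` is non-permutable on both sides, e.g. `(U⁻⋊C₁, K' ≤ non-split
  torus, U⁺⋊C₃)` with `|C_i| ≈ √p`, `|K'| ≈ p^{3/2}` — not excluded by NormalizerBarrier
  (`(s₁s₂s₃)^{1/4} ≈ p^{0.88}`, cap `p^{5.1}`); its TPP reduces to "no `k ∈ K'∖1` with `k₁₁ ∈ A₁`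
  and `N(k)/k₁₁ ∈ A₃`" (expected `≈ c²√p` violations for generic choices; kit j012113 of ideator 2
  finds wall-feasible lucky instances at 48/78 primes `≤ 400`), and its SEPARATION is dead for all
  `p` as soon as `|C₁|, |C₃| ≥ 2` by the torus-rectangle relation (`not_rankSep_of_torus_rectangle`,
  ideator 2's obstruction, proved below; kit j012178/j012241 confirm numerically at `p ≤ 41`).  With
  `|C₁| = 1` (resp. `|C₃| = 1`) an outer piece has size `p < c p^{3/2}`: so NO subgroup triple of
  Borel-unipotent outer type can witness the crux, and three toral pieces are capped at `≈ 8p⁴` by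
  ideator 2's central squeeze.  Remaining subgroup shapes (e.g. toral outer pieces in two different
  non-split tori with a Borel-type middle `U⋊C`, `C` a 'graph' torus) are not yet excluded.

## Calibration (this seat; TPP-ONLY capacity of the natural template, pure Python, `torus_template.py`)
Template `X = {[a 0; c 1] : a ∈ A₁}` (`= U⁻⋊A₁`), `Z = {[1 b; 0 d] : d ∈ A₃}` (`= U⁺⋊A₃`), `A_i ≤ 𝔽_p^×`
subgroups, `Y = {g^i : i < n}` a geometric progression in the non-split torus `K` (so `|Q(Y)| = 2n − 1`,
the cheapest possible middle).  TPP ⇔ `g^{±j} ∉ XZ` for `1 ≤ j < n`, and `k ∈ XZ ⇔ k₁₁ ∈ A₁ ∧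
N(k)/k₁₁ ∈ A₃` — density `a₁a₃/p²` in `K`, so the first bad exponent is `≈ p²/(a₁a₃)` and
**`V = p a₁ · p²/(a₁a₃) · p a₃ ≈ p⁴` identically**: the template is a `p⁴`-family whatever the
thinning.  Measured maxima of `V/p⁴` over all divisor pairs `(a₁,a₃)`: `p = 7: 1.96, 11: 1.65,
13: 0.99, 17: 1.99, 19: 1.20, 23: 2.00, 29: 1.13, 31: 2.00, 37: 3.00, 41: 4.00, 43: 1.43` (small-`a`
luck, e.g. `p = 41`: `(164, 420, 164)`, `min = 0.62 p^{3/2}` but graded Neumann is violated, so it is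
not even a candidate for separation).  Balancing `p a = p²/a²` gives `a = p^{1/3}` and
`min(|X|,|Y|,|Z|) ≈ p^{4/3}` — short of the crux's `p^{3/2}` by `p^{1/6}`, for TPP alone.  Random-model
Borel–Cantelli for a middle of length `c p^{3/2}`: it needs a gap `c²√p` times the mean gap of the bad
exponents, probability `≈ p² e^{−c²√p}` per prime — summable, so "unboundedly many primes" would need
an arithmetic REASON, not luck.  Walls-compliant TPP instances worth testing for SEPARATION (kit
j011883, template batch `p = 5, 7, 11, 13`; balanced-growth jobs j011530/32/34/36): `p = 13: (26, 30,
26)`, `V = 0.63 B₃`; `p = 19: (57, 48, 57)`, `V = 155952 = 1.09·B₃(19)`, graded Neumann OK — if that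
one were rank-1-separated it would settle the `(2,1)` cell of `LieRankBeatsCubes` POSITIVELY (flagged
to that seat; beyond this seat's exact oracle, `W(19) = 7162`).  All separated designs known so far
have `V ≤ 1.3·W` (`(U⁻,T₁,U⁺)`: `p²(p−1)`; kit j008119/j008121 bests `(10,1,37)`, `(15,2,14)`,
`(7,2,12)`): the live empirical question is whether separation ever allows `V ≫ W`, let alone
`W^{3/2}`.
KIT RESULTS (this seat, exact oracle mod two large primes, every record re-verified with a fresh
random projection).  (1) TEMPLATE SEPARABILITY, j011883 (`p = 5, 7, 11`; `p = 13` timed out):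
`X = U⁻⋊μ_{a₁}`, `Z = U⁺⋊μ_{a₃}`, `Y = {g^i : i < n} ⊂ K`: every pair with `a₁, a₃ ≥ 2` is NOT
separated already at `Y = {1}` (the torus rectangle, `not_rankSep_of_torus_rectangle`, seen
numerically); `a₃ = 1 < a₁`: exactly `n = 1` separates (trivial middle = permutable pair, `V ≤ W`)
and `n = 2` fails; `a₁ = a₃ = 1` (`(U⁻, K-progression, U⁺)`, TPP for the FULL torus, `n = p²−1`):
separated only up to `n = 2, 3, 4` (fails at `3, 4, 6`) for `p = 5, 7, 11` — `V_sep ≈ 3p² ≪ W`.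
(2) BALANCED RANDOM GROWTH to maximal separated triples, j011530/j011532 (`p = 5`, `W = 134`,
`p^{3/2} ≈ 11`): 455 + 265 restarts, best `min(|X|,|Y|,|Z|) = 4` (`(4,4,4) … (5,4,6)`, `V ≤ 120 <
W`), maximal elements cluster at `(4,4,3)`; j011534/j011536 (`p = 7`, `W = 370`, `p^{3/2} ≈ 18.5`):
best `min = 5` unrestricted (`(5,5,5)`), `6` with `X ⊆ B⁻, Z ⊆ B⁺, Y ⊆ K` (`(6,6,7)`, `V = 252 <
W`), against the graded-Neumann allowance `(11, 22, 11)`.  Every separated triple this chain has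
ever produced has `V < 1.3·W`; the crux needs `V ≈ W^{3/2}`.

## Findings (index; all at `(m,k) = (2,1)`)
* `levelOneGL2Designs_iff` — the crux is `∃ c > 0, LevelOneGL2DesignsConst c` in the sibling
  vocabulary (`Iff.rfl`).
* `rank_le_one_iff_det_eq_zero`, `card_GL2`, `card_mat2`, `card_rankLE_two_one` — **`N₁(p) =
  #{M ∈ M_2(𝔽_p) : rk M ≤ 1} = p³ + p² − p`** exactly (`= p⁴ − |GL_2(𝔽_p)|`, Mathlib
  `Matrix.card_GL_field`).
* `wall_XY_levelOne`, `wall_XZ_levelOne`, `wall_YZ_levelOne`, `neumann_X_levelOne`,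
  `neumann_Z_levelOne` — the three walls and the graded Neumann count with the explicit `N₁(p)`.
* `tpp_levelOne`, `pigeonhole_levelOne` — every witness is a TPP triple (so QuasirandomBarrier
  applies, vacuously) and, for odd `p`, `|X||Y| + |Y||Z| ≤ |GL_2(𝔽_p)|` (sibling's pigeonhole).
* `not_levelOneGL2DesignsExp` — STRENGTHENING REFUTED: the crux with `p^{3/2}` replaced by `p^e`,
  `e > 3/2`, is false (wall `|X||Z| ≤ N₁ < 2p³`).  The exponent is tight.
* `not_levelOneGL2DesignsConst` — STRENGTHENING REFUTED: for every `c > 1/√2` the constant-`c`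
  slice is false (graded Neumann: `2c²p³ − cp^{3/2} ≤ p³ + p²` fails for large `p`); so
  `LevelOneGL2Designs ↔ ∃ c ∈ (0, 1/√2], LevelOneGL2DesignsConst c` (`levelOneGL2Designs_iff_small`).
* `beatsCubes_of_levelOneGL2Designs` — KILL TRANSFER: the crux implies that the exponent-3
  milestone of the `(2,1)` cell (`LevelOneBeatsCubesAt p`: some rank-1-separated triple with
  `V > B₃(p) = 1 + p³ + (p−2)(p+1)³`) holds for unboundedly many `p`; contrapositive
  `not_levelOneGL2Designs_of_eventually_not_beatsCubes`: if the `(2,1)` cell of `LieRankBeatsCubes`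
  is empty for all large `p` (it is empty for `p ≤ 7` by the sibling's count), the crux is dead.
* `not_levelOneGL2Designs_of_packingBound` — KILL CRITERION: any level-one packing bound
  `V ≤ C·p⁴` refutes the crux (the conjectural graded-mixing lemma would give `C ≈ 0.4`).
* `card_tripleProducts_le_finrank`, `card_mul_card_mul_card_le_finrank_of_permutable` (general
  finite group, general bi-invariant `J`) — PERMUTABLE SUBGROUP DESIGNS ARE `J`-INTERPOLATION SETS:
  `|H₁H₂H₃| ≤ dim J`, and with TPP `|H₁||H₂||H₃| ≤ dim J`.  Route-level negative lemma (also bites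
  the sibling crux SubgroupIdentityDesigns, stmt-14079, for any template whose middle group
  permutes with an outer one).
* `levelSubmodule_bi_inv`, `volume_le_of_permutable_subgroups`, `volume_le_of_permutable_subgroups'`
  — at `(2,1)`: rank-1-separated permutable subgroup triples have `V ≤ N₁(p) = p³ + p² − p`.
* `not_levelOneGL2Designs_permutableSubgroups` — ARCHITECTURE KILL: the crux restricted to
  permutable subgroup triples (split-torus / trivial middles over unipotent outer groups) is FALSE.
* `Moat.card_mul_finrank_inf_Supp_le`, `Moat.card_mul_finrank_inf_SuppFun_le` (general finite
  group, any left-invariant `J ≤ ℂ^G`), `Moat.moat` (every `(m,k)`), `moat_levelOne` — ideator 3's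
  MOAT INEQUALITY, PROVED: `|G|·dim(J ∩ ℂ^S) ≤ |S|·dim J`, hence
  `|G|·|X||Z| ≤ |G ∖ garbage|·N_k` for every `F_k`-separated triple: the garbage of a crux witness
  misses `≥ (c² − o(1))|GL_2(𝔽_p)|` elements (thin-`P` / Borel-confinement pressure, quantified).
* `rectangle_orth_transl`, `not_rankSep_of_translated_rectangle` (MASTER FORM: any two-sided
  translate of the rectangle inside `P` with its corner on a target kills separation),
  `not_rankSep_of_middle_rectangle` (rectangle realised by the middle quotient set `Q(Y) ⊇ C·U⁺`,
  `C ∋ diag(a',1), diag(1,d')` — every non-graph torus subgroup in a Borel-type middle — with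
  `1 ∈ X ∩ Z`) — so among SUBGROUP triples with a Borel-type piece `U⋊C` anywhere, only 'graph'
  tori `C = {(φ(d), d)}` escape the rectangle.
* `rectangle_orth` — ideator 2's RECTANGLE RELATION, PROVED (closes the `sorry` of
  `Ideator2Sketch.rectangle_orth`; same statement in a verbatim vocabulary): the signed indicator of
  the four cosets `diag(a,d)U⁺ ± …` of a torus rectangle is orthogonal to every level-one test
  function (`Σ_N rect·ψ(tr MN) = (Σ_x ψ(M₁₀x))·(ψ(M₀₀a)−ψ(M₀₀a'))(ψ(M₁₁d)−ψ(M₁₁d'))` and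
  `rk M ≤ 1, M₁₀ = 0 ⇒ M₀₀M₁₁ = 0`).
* `not_rankSep_of_torus_rectangle` — TEMPLATE KILL (ideator 2's prediction, now a theorem for every
  `p` and every middle set): `1 ∈ X`, some `x₁ ∈ X` with `x₁⁻¹ = diag(a',1)`, `Y ≠ ∅`,
  `Z ⊇ U⁺ ∪ diag(1,d')U⁺` (`a', d' ∉ {0,1}`) ⇒ NOT rank-1-separated.  Kills the last subgroup
  shape `(U⁻⋊C₁, K' ≤ non-split torus, U⁺⋊C₃)` with `|C₁|, |C₃| ≥ 2` (the permutability theorem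
  needs `H₁H₂ = H₂H₁`; this needs nothing of the middle), and re-derives `(Aff⁺,T₂,U⁻)` ✗.

## Landed under `Theorems/LevelOneGL2Designs/Negative/` (kernel-checked, `--supports` the crux)
`PermutableSubgroups.lean` (p82064, general permutable wall theorem), `Moat.lean` (p82723, general
moat inequality), `Exponent.lean` (p83507, `N₁` count, wall, exponent tightness), `Milestone.lean`
(p84811, kill transfer + packing criterion), `LevelSpace.lean` (p85513, `F_k|_G` as a bi-invariant
submodule, product sets); submitted: `ConstantWindow.lean` (p87619), `PermutableGL2.lean` (p87751),
`Rectangle.lean` (p87925), `MoatDesign.lean` (p88064).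

## Targets
`payload.targets = []`, `stuck_stubs = []` at cycle 1 (no line picked yet).  When the lead's stubs
arrive they are attacked here first.

## Not yet formalised (closable, deferred)
The sharp wall `|X||Y| ≤ dim F_1|_G = p³ + p² − 3p − 1` (needs the `2p + 1` linear relations among
the `ψ(tr(M·))|_G`, `rk M ≤ 1`: constants counted `p + 1` times and the `p` relations from
`Σ_{u ∈ ℓ} 1[gu = w]`); the `4p`-support description of the minimal elements of `F_1^⊥`.
-/

set_option linter.dupNamespace false

noncomputable section

open scoped BigOperators ComplexConjugate InnerProductSpace

namespace Summit.MatrixMultiplication.MatrixMultiplication.Cruxes.LevelOneGL2Designs.Disproof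

open Summit.MatrixMultiplication.MatrixMultiplication.Theses.LevelGradedCohnUmans
open Summit.MatrixMultiplication.MatrixMultiplication.Cruxes.LieRankDesigns.Disproof
open Literature.Barriers.MatrixMultiplication (SubgroupTPP)

variable {p : ℕ}

/-! ## The crux in the sibling vocabulary -/

/-- The constant-`c` slice of the crux: wall-saturating rank-1-separated triples in `GL_2(𝔽_p)` with
all three sets `≥ c·p^{3/2}`, along an unbounded set of primes. -/
def LevelOneGL2DesignsConst (c : ℝ) : Prop :=
  ∀ p₀ : ℕ, ∃ (p : ℕ) (_ : Fact p.Prime), p₀ ≤ p ∧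
    ∃ X Y Z : Finset (GLm p 2), RankSep 1 X Y Z ∧
      c * (p : ℝ) ^ (3 / 2 : ℝ) ≤ X.card ∧ c * (p : ℝ) ^ (3 / 2 : ℝ) ≤ Y.card ∧
      c * (p : ℝ) ^ (3 / 2 : ℝ) ≤ Z.card

/-- The crux, restated in the sibling seat's vocabulary (`GLm p 2`, `RankSep 1`) — by `Iff.rfl`, so
nothing below drifts from the statement as filed. -/
theorem levelOneGL2Designs_iff :
    LevelOneGL2Designs ↔ ∃ c : ℝ, 0 < c ∧ LevelOneGL2DesignsConst c :=
  Iff.rfl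

/-! ## The exact level-one support count `N₁(p) = p³ + p² − p` -/

section Count

variable [Fact p.Prime]

/-- For a `2 × 2` matrix over `𝔽_p`: Fourier rank `≤ 1` iff singular. [folklore] -/
theorem rank_le_one_iff_det_eq_zero (M : Mat p 2) : M.rank ≤ 1 ↔ M.det = 0 := by
  constructor
  · intro h
    by_contra hdet
    have hU : IsUnit M :=
      (Matrix.isUnit_iff_isUnit_det M).mpr (isUnit_iff_ne_zero.mpr hdet)
    have h2 := Matrix.rank_of_isUnit M hU
    rw [Fintype.card_fin] at h2
    omega
  · intro hdet
    have hlt : M.rank < 2 := by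
      refine lt_of_le_of_ne (by simpa using Matrix.rank_le_card_width M) fun hr => ?_
      have hsurj : Function.Surjective M.mulVec := by
        have htop : LinearMap.range M.mulVecLin = ⊤ := by
          apply Submodule.eq_top_of_finrank_eq
          rw [Module.finrank_fintype_fun_eq_card, Fintype.card_fin]
          exact hr
        intro v
        have hv : v ∈ LinearMap.range M.mulVecLin := htop ▸ Submodule.mem_top
        obtain ⟨w, hw⟩ := hv
        exact ⟨w, hw⟩
      have hunit : IsUnit M := Matrix.mulVec_surjective_iff_isUnit.1 hsurj
      exact ((Matrix.isUnit_iff_isUnit_det M).1 hunit).ne_zero hdet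
    omega

/-- `|GL_2(𝔽_p)| = (p² − 1)(p² − p)`. [folklore] -/
theorem card_GL2 : Fintype.card (GLm p 2) = (p ^ 2 - 1) * (p ^ 2 - p) := by
  rw [Fintype.card_eq_nat_card, Matrix.card_GL_field]
  simp [Fin.prod_univ_two, ZMod.card]

/-- The invertible matrices, as the subtype `det ≠ 0` of all matrices. -/
def glEquivDetNeZero : GLm p 2 ≃ {M : Mat p 2 // ¬ M.det = 0} where
  toFun g := ⟨(g : Mat p 2), ((Matrix.isUnit_iff_isUnit_det _).mp (Units.isUnit g)).ne_zero⟩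
  invFun M := Matrix.GeneralLinearGroup.mkOfDetNeZero M.1 M.2
  left_inv _ := Units.ext rfl
  right_inv _ := Subtype.ext rfl

/-- `#M_2(𝔽_p) = p⁴`. -/
theorem card_mat2 : Fintype.card (Mat p 2) = p ^ 4 := by
  simp [Matrix, Fintype.card_fin, ZMod.card]
  ring

/-- **Exact size of the level-one Fourier support**: `N₁(p) = #{M ∈ M_2(𝔽_p) : rk M ≤ 1} =
p³ + p² − p` (the singular matrices, `p⁴ − |GL_2(𝔽_p)|`).  This is the `N_k` of the sibling seat's
walls at `(m,k) = (2,1)`; the true dimension `dim F_1|_G = p³ + p² − 3p − 1` is smaller by `2p + 1`.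
[folklore] -/
theorem card_rankLE_two_one : Fintype.card (RankLE p 2 1) = p ^ 3 + p ^ 2 - p := by
  classical
  have h1 : Fintype.card (RankLE p 2 1) = Fintype.card {M : Mat p 2 // M.det = 0} :=
    Fintype.card_congr (Equiv.subtypeEquivRight fun M => rank_le_one_iff_det_eq_zero M)
  have h2 : Fintype.card {M : Mat p 2 // ¬ M.det = 0} = (p ^ 2 - 1) * (p ^ 2 - p) := by
    rw [← card_GL2]; exact (Fintype.card_congr glEquivDetNeZero).symm
  have h3 : Fintype.card {M : Mat p 2 // M.det = 0} + Fintype.card {M : Mat p 2 // ¬ M.det = 0}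
      = p ^ 4 := by
    rw [Fintype.card_subtype_compl, ← card_mat2]
    exact Nat.add_sub_of_le (Fintype.card_subtype_le _)
  rw [h1]
  rw [h2] at h3
  have hp : 1 ≤ p := (Fact.out : p.Prime).one_lt.le
  have hp2 : p ≤ p ^ 2 := by nlinarith
  have hp1 : 1 ≤ p ^ 2 := le_trans hp hp2
  zify [hp1, hp2, show p ≤ p ^ 3 + p ^ 2 by nlinarith] at h3 ⊢
  linear_combination h3

/-- The crude form used by the asymptotic refutations: `N₁(p) ≤ p³ + p²`. -/
theorem card_rankLE_two_one_le : Fintype.card (RankLE p 2 1) ≤ p ^ 3 + p ^ 2 := by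
  rw [card_rankLE_two_one]; exact Nat.sub_le _ _

end Count

/-! ## Walls, graded Neumann, TPP and pigeonhole at `(2,1)` with the explicit `N₁(p)` -/

section Walls21

variable [Fact p.Prime] {X Y Z : Finset (GLm p 2)}

/-- Wall `XY` at level one: `|X|·|Y| ≤ p³ + p² − p`. -/
theorem wall_XY_levelOne (hsep : RankSep 1 X Y Z) (hZ : Z.Nonempty) :
    X.card * Y.card ≤ p ^ 3 + p ^ 2 - p := by
  rw [← card_rankLE_two_one]; exact wall_XY hsep hZ

/-- Wall `XZ` at level one: `|X|·|Z| ≤ p³ + p² − p`. -/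
theorem wall_XZ_levelOne (hsep : RankSep 1 X Y Z) (hY : Y.Nonempty) :
    X.card * Z.card ≤ p ^ 3 + p ^ 2 - p := by
  rw [← card_rankLE_two_one]; exact wall_XZ hsep hY

/-- Wall `YZ` at level one: `|Y|·|Z| ≤ p³ + p² − p`. -/
theorem wall_YZ_levelOne (hsep : RankSep 1 X Y Z) (hX : X.Nonempty) :
    Y.card * Z.card ≤ p ^ 3 + p ^ 2 - p := by
  rw [← card_rankLE_two_one]; exact wall_YZ hsep hX

/-- **Graded Neumann count at level one, `X`-slab**: `|X||Z| + |X|(|Y| − 1) ≤ p³ + p² − p`. -/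
theorem neumann_X_levelOne (hsep : RankSep 1 X Y Z) {y₁ z₁ : GLm p 2} (hy₁ : y₁ ∈ Y)
    (hz₁ : z₁ ∈ Z) : X.card * Z.card + X.card * (Y.card - 1) ≤ p ^ 3 + p ^ 2 - p := by
  rw [← card_rankLE_two_one]; exact neumann_X hsep hy₁ hz₁

/-- **Graded Neumann count at level one, `Z`-slab**: `|X||Z| + (|Y| − 1)|Z| ≤ p³ + p² − p`. -/
theorem neumann_Z_levelOne (hsep : RankSep 1 X Y Z) {x₁ y₁ : GLm p 2} (hx₁ : x₁ ∈ X)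
    (hy₁ : y₁ ∈ Y) : X.card * Z.card + (Y.card - 1) * Z.card ≤ p ^ 3 + p ^ 2 - p := by
  rw [← card_rankLE_two_one]; exact neumann_Z hsep hx₁ hy₁

/-- Every witness is a TPP triple (sibling `tpp_of_rankSep`), so every catalogued TPP cap applies —
all vacuous at `V ≈ p^{4.5}` (`BCGPU2023_thm32`: `≈ p^{5.5}`). -/
theorem tpp_levelOne (hsep : RankSep 1 X Y Z) :
    Literature.Combinatorics.Additive.TripleProductProperty X Y Z :=
  tpp_of_rankSep hsep

/-- The sibling's pigeonhole at `(2,1)`, `p` odd: `|X||Y| + |Y||Z| ≤ |GL_2(𝔽_p)| = (p²−1)(p²−p)`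
(else `X⁻¹Y · Y⁻¹Z = G` and a separating function would be a delta, which has level `2`). -/
theorem pigeonhole_levelOne (hp : p ≠ 2) (hsep : RankSep 1 X Y Z) (hX : X.Nonempty)
    (hZ : Z.Nonempty) : X.card * Y.card + Y.card * Z.card ≤ (p ^ 2 - 1) * (p ^ 2 - p) := by
  rw [← card_GL2]; exact card_XY_add_card_YZ_le hp (by norm_num) hsep hX hZ

end Walls21

/-! ## Real-exponent bookkeeping shared by the asymptotic statements -/

section Rpow

variable [Fact p.Prime]

theorem p_pos : (0 : ℝ) < p := by exact_mod_cast (Fact.out : p.Prime).pos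

theorem one_le_p : (1 : ℝ) ≤ p := by exact_mod_cast (Fact.out : p.Prime).one_lt.le

/-- `p^{3/2} · p^{3/2} = p³`. -/
theorem rpow_three_halves_mul_self :
    (p : ℝ) ^ (3 / 2 : ℝ) * (p : ℝ) ^ (3 / 2 : ℝ) = (p : ℝ) ^ 3 := by
  rw [← Real.rpow_add p_pos, show (3 / 2 : ℝ) + 3 / 2 = ((3 : ℕ) : ℝ) by norm_num,
    Real.rpow_natCast]

/-- `p ≤ p^{3/2} ≤ p²`. -/
theorem p_le_rpow_three_halves : (p : ℝ) ≤ (p : ℝ) ^ (3 / 2 : ℝ) := by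
  conv_lhs => rw [← Real.rpow_one (p : ℝ)]
  exact Real.rpow_le_rpow_of_exponent_le one_le_p (by norm_num)

theorem rpow_three_halves_le_sq : (p : ℝ) ^ (3 / 2 : ℝ) ≤ (p : ℝ) ^ 2 := by
  have h := Real.rpow_le_rpow_of_exponent_le (one_le_p (p := p)) (show (3 / 2 : ℝ) ≤ (2 : ℕ) by
    norm_num)
  rwa [Real.rpow_natCast] at h

omit [Fact p.Prime] in
/-- Lower bounds on two sets multiply: `(c p^e)² ≤ |A|·|B|` (as reals). -/
theorem sq_le_card_mul {c e : ℝ} (hc : 0 ≤ c) {a b : ℕ} (ha : c * (p : ℝ) ^ e ≤ a)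
    (hb : c * (p : ℝ) ^ e ≤ b) : (c * (p : ℝ) ^ e) * (c * (p : ℝ) ^ e) ≤ ((a * b : ℕ) : ℝ) := by
  push_cast
  exact mul_le_mul ha hb (by positivity) (le_trans (by positivity) ha)

/-- The wall in real form: `|X|·|Z| ≤ p³ + p²` for a level-one witness. -/
theorem wall_XZ_real {X Y Z : Finset (GLm p 2)} (hsep : RankSep 1 X Y Z) (hY : Y.Nonempty) :
    ((X.card * Z.card : ℕ) : ℝ) ≤ (p : ℝ) ^ 3 + (p : ℝ) ^ 2 := by
  have h := (wall_XZ hsep hY).trans card_rankLE_two_one_le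
  exact_mod_cast h

end Rpow

/-! ## STRENGTHENING REFUTED: the exponent `3/2` cannot be raised -/

section Exponent

/-- The crux with `p^{3/2}` replaced by `p^e`. (`e = 3/2` is the crux: `levelOneGL2Designs_iff_exp`.) -/
def LevelOneGL2DesignsExp (e : ℝ) : Prop :=
  ∃ c : ℝ, 0 < c ∧ ∀ p₀ : ℕ, ∃ (p : ℕ) (_ : Fact p.Prime), p₀ ≤ p ∧
    ∃ X Y Z : Finset (GLm p 2), RankSep 1 X Y Z ∧
      c * (p : ℝ) ^ e ≤ X.card ∧ c * (p : ℝ) ^ e ≤ Y.card ∧ c * (p : ℝ) ^ e ≤ Z.card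

theorem levelOneGL2Designs_iff_exp : LevelOneGL2Designs ↔ LevelOneGL2DesignsExp (3 / 2) := Iff.rfl

/-- **The exponent is tight.**  For every `e > 3/2` the `p^e`-version of the crux is FALSE: the wall
`|X||Z| ≤ N₁(p) ≤ p³ + p² < 2p³ ≤ c²p^{2e}` once `p^{2e−3} ≥ 2/c²`.  (Only the `X`- and `Z`-bounds and
`Y ≠ ∅` are used.) -/
theorem not_levelOneGL2DesignsExp {e : ℝ} (he : 3 / 2 < e) : ¬ LevelOneGL2DesignsExp e := by
  rintro ⟨c, hc, hall⟩
  have hδ : 0 < 2 * e - 3 := by linarith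
  -- threshold: p ≥ N forces c² p^{2e-3} ≥ 2
  set K : ℝ := (2 / c ^ 2) ^ (1 / (2 * e - 3)) with hK
  obtain ⟨N, hN⟩ := exists_nat_gt (max 2 K)
  obtain ⟨p, hprime, hNp, X, Y, Z, hsep, hX, hY, hZ⟩ := hall N
  have hp0 : (0 : ℝ) < p := p_pos
  have hNR : (N : ℝ) ≤ p := by exact_mod_cast hNp
  have hKp : K ≤ p := le_trans (le_trans (le_max_right _ _) hN.le) hNR
  have h2p : (2 : ℝ) < p := lt_of_lt_of_le (lt_of_le_of_lt (le_max_left _ _) hN) hNR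
  -- p^{2e-3} ≥ 2/c²
  have hpow : 2 / c ^ 2 ≤ (p : ℝ) ^ (2 * e - 3) := by
    have h1 : K ^ (2 * e - 3) ≤ (p : ℝ) ^ (2 * e - 3) :=
      Real.rpow_le_rpow (by positivity) hKp hδ.le
    have h2 : K ^ (2 * e - 3) = 2 / c ^ 2 := by
      rw [hK, ← Real.rpow_mul (by positivity)]
      have : 1 / (2 * e - 3) * (2 * e - 3) = 1 := by field_simp
      rw [this, Real.rpow_one]
    rwa [h2] at h1
  -- Y is nonempty
  have hYne : Y.Nonempty := by
    rw [← Finset.card_pos]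
    have : (0 : ℝ) < Y.card := lt_of_lt_of_le (by positivity) hY
    exact_mod_cast this
  -- lower bound c² p^{2e} ≤ |X||Z|
  have hlow := sq_le_card_mul hc.le hX hZ
  have hup := wall_XZ_real hsep hYne
  -- c² p^{2e} = c² p^{2e-3} p³ ≥ 2 p³
  have hsplit : (c * (p : ℝ) ^ e) * (c * (p : ℝ) ^ e) = c ^ 2 * (p : ℝ) ^ (2 * e - 3) * (p : ℝ) ^ 3 := by
    have : (p : ℝ) ^ e * (p : ℝ) ^ e = (p : ℝ) ^ (2 * e - 3) * (p : ℝ) ^ 3 := by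
      rw [← Real.rpow_add hp0, ← Real.rpow_natCast, ← Real.rpow_add hp0]
      congr 1; push_cast; ring
    calc (c * (p : ℝ) ^ e) * (c * (p : ℝ) ^ e) = c ^ 2 * ((p : ℝ) ^ e * (p : ℝ) ^ e) := by ring
      _ = c ^ 2 * (p : ℝ) ^ (2 * e - 3) * (p : ℝ) ^ 3 := by rw [this]; ring
  have hge : 2 * (p : ℝ) ^ 3 ≤ c ^ 2 * (p : ℝ) ^ (2 * e - 3) * (p : ℝ) ^ 3 := by
    have hc2 : 0 < c ^ 2 := by positivity
    have : 2 ≤ c ^ 2 * (p : ℝ) ^ (2 * e - 3) := by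
      have := mul_le_mul_of_nonneg_left hpow hc2.le
      rwa [mul_div_cancel₀ _ hc2.ne'] at this
    have hp3 : 0 ≤ (p : ℝ) ^ 3 := by positivity
    nlinarith
  -- but p³ + p² < 2p³ for p > 1
  have hlt : (p : ℝ) ^ 3 + (p : ℝ) ^ 2 < 2 * (p : ℝ) ^ 3 := by nlinarith
  linarith [hlow, hup, hge, hlt, hsplit.symm.le, hsplit.le]

end Exponent

/-! ## STRENGTHENING REFUTED: the constant window is `c ≤ 1/√2` (graded Neumann is tight here) -/

section Constant

/-- **No constant above `1/√2`.**  For `2c² > 1` the constant-`c` slice is FALSE: graded Neumann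
gives `|X||Z| + |X|(|Y|−1) ≤ N₁(p) ≤ p³ + p²`, while the size bounds give
`≥ 2c²p³ − c p^{3/2} ≥ 2c²p³ − cp²`, absurd once `(2c² − 1)p > 1 + c`. -/
theorem not_levelOneGL2DesignsConst_of_sq {c : ℝ} (hc : 0 < c) (hc2 : 1 < 2 * c ^ 2) :
    ¬ LevelOneGL2DesignsConst c := by
  intro hall
  obtain ⟨N, hN⟩ := exists_nat_gt (max (1 / c) ((1 + c) / (2 * c ^ 2 - 1)))
  obtain ⟨p, hprime, hNp, X, Y, Z, hsep, hX, hY, hZ⟩ := hall N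
  have hp0 : (0 : ℝ) < p := p_pos
  have hNR : (N : ℝ) ≤ p := by exact_mod_cast hNp
  have h1c : 1 / c < p := lt_of_lt_of_le (lt_of_le_of_lt (le_max_left _ _) hN) hNR
  have hthr : (1 + c) / (2 * c ^ 2 - 1) < p :=
    lt_of_lt_of_le (lt_of_le_of_lt (le_max_right _ _) hN) hNR
  set L : ℝ := c * (p : ℝ) ^ (3 / 2 : ℝ) with hL
  have hL1 : 1 ≤ L := by
    have h1 : 1 < c * p := by
      have := (div_lt_iff₀ hc).mp h1c
      linarith [this]
    have h2 : c * p ≤ L := mul_le_mul_of_nonneg_left p_le_rpow_three_halves hc.le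
    linarith
  -- nonemptiness
  have hpos : ∀ {S : Finset (GLm p 2)}, L ≤ S.card → S.Nonempty := by
    intro S hS
    rw [← Finset.card_pos]
    have : (0 : ℝ) < S.card := lt_of_lt_of_le (by linarith) hS
    exact_mod_cast this
  obtain ⟨y₁, hy₁⟩ := hpos hY
  obtain ⟨z₁, hz₁⟩ := hpos hZ
  -- graded Neumann, real form
  have hneu : ((X.card * Z.card + X.card * (Y.card - 1) : ℕ) : ℝ) ≤ (p : ℝ) ^ 3 + (p : ℝ) ^ 2 := by
    exact_mod_cast (neumann_X hsep hy₁ hz₁).trans card_rankLE_two_one_le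
  have hY1 : 1 ≤ Y.card := Finset.card_pos.mpr ⟨y₁, hy₁⟩
  have hcast : ((X.card * Z.card + X.card * (Y.card - 1) : ℕ) : ℝ)
      = (X.card : ℝ) * Z.card + X.card * ((Y.card : ℝ) - 1) := by
    push_cast [Nat.cast_sub hY1]; ring
  rw [hcast] at hneu
  -- lower bounds
  have hXZ : L * L ≤ (X.card : ℝ) * Z.card := mul_le_mul hX hZ (by linarith) (le_trans (by linarith) hX)
  have hXY : L * (L - 1) ≤ (X.card : ℝ) * ((Y.card : ℝ) - 1) :=
    mul_le_mul hX (by linarith) (by linarith) (le_trans (by linarith) hX)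
  have hLL : L * L = c ^ 2 * (p : ℝ) ^ 3 := by
    rw [hL]; calc c * (p : ℝ) ^ (3 / 2 : ℝ) * (c * (p : ℝ) ^ (3 / 2 : ℝ))
        = c ^ 2 * ((p : ℝ) ^ (3 / 2 : ℝ) * (p : ℝ) ^ (3 / 2 : ℝ)) := by ring
      _ = c ^ 2 * (p : ℝ) ^ 3 := by rw [rpow_three_halves_mul_self]
  have hLp2 : L ≤ c * (p : ℝ) ^ 2 := mul_le_mul_of_nonneg_left rpow_three_halves_le_sq hc.le
  -- combine: 2c²p³ − c p² ≤ p³ + p²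
  have hmain : 2 * c ^ 2 * (p : ℝ) ^ 3 - c * (p : ℝ) ^ 2 ≤ (p : ℝ) ^ 3 + (p : ℝ) ^ 2 := by
    nlinarith
  -- contradiction with p > (1+c)/(2c²−1)
  have hden : 0 < 2 * c ^ 2 - 1 := by linarith
  have hthr' : 1 + c < (2 * c ^ 2 - 1) * p := by
    have := (div_lt_iff₀ hden).mp hthr
    linarith
  have hp2 : 0 < (p : ℝ) ^ 2 := by positivity
  nlinarith [mul_lt_mul_of_pos_right hthr' hp2]

/-- The same with the threshold written as `1/√2 < c`. -/
theorem not_levelOneGL2DesignsConst {c : ℝ} (hc : 1 / Real.sqrt 2 < c) :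
    ¬ LevelOneGL2DesignsConst c := by
  have h0 : 0 < 1 / Real.sqrt 2 := by positivity
  have hc0 : 0 < c := lt_trans h0 hc
  refine not_levelOneGL2DesignsConst_of_sq hc0 ?_
  have h := mul_self_lt_mul_self h0.le hc
  have h2 : 1 / Real.sqrt 2 * (1 / Real.sqrt 2) = 1 / 2 := by
    rw [div_mul_div_comm, one_mul, Real.mul_self_sqrt (by norm_num)]
  rw [h2] at h
  nlinarith

/-- Monotonicity in the constant. -/
theorem levelOneGL2DesignsConst_mono {c c' : ℝ} (hcc : c' ≤ c) (h : LevelOneGL2DesignsConst c) :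
    LevelOneGL2DesignsConst c' := by
  intro p₀
  obtain ⟨p, hprime, hp, X, Y, Z, hsep, hX, hY, hZ⟩ := h p₀
  have hm : c' * (p : ℝ) ^ (3 / 2 : ℝ) ≤ c * (p : ℝ) ^ (3 / 2 : ℝ) :=
    mul_le_mul_of_nonneg_right hcc (by positivity)
  exact ⟨p, hprime, hp, X, Y, Z, hsep, hm.trans hX, hm.trans hY, hm.trans hZ⟩

/-- **The constant window.**  The crux is equivalent to its restriction to constants
`c ∈ (0, 1/√2]`: larger constants are refuted by graded Neumann, smaller ones are implied by
monotonicity. -/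
theorem levelOneGL2Designs_iff_small :
    LevelOneGL2Designs ↔ ∃ c : ℝ, 0 < c ∧ c ≤ 1 / Real.sqrt 2 ∧ LevelOneGL2DesignsConst c := by
  rw [levelOneGL2Designs_iff]
  constructor
  · rintro ⟨c, hc, h⟩
    by_cases hle : c ≤ 1 / Real.sqrt 2
    · exact ⟨c, hc, hle, h⟩
    · exact absurd h (not_levelOneGL2DesignsConst (lt_of_not_ge hle))
  · rintro ⟨c, hc, -, h⟩
    exact ⟨c, hc, h⟩

end Constant

/-! ## KILL TRANSFER: the crux implies the exponent-3 milestone of the `(2,1)` cell cofinally -/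

section Milestone

/-- The exponent-3 milestone of the `(2,1)` cell at the prime `p` (the `(m,k) = (2,1)` instance of
the route item `LieRankBeatsCubes`, stmt-14057, with the level-one budget in closed form
`B₃(p) = 1 + p³ + (p−2)(p+1)³`): some rank-1-separated triple in `GL_2(𝔽_p)` has `|X||Y||Z| > B₃(p)`.
EMPTY for `p ≤ 7` (sibling Disproof: sharp graded Neumann), open from `p = 11`. -/
def LevelOneBeatsCubesAt (p : ℕ) [Fact p.Prime] : Prop :=
  ∃ X Y Z : Finset (GLm p 2), RankSep 1 X Y Z ∧
    1 + p ^ 3 + (p - 2) * (p + 1) ^ 3 < X.card * Y.card * Z.card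

/-- Crude bound `B₃(p) ≤ 10 p⁴`. -/
theorem budget3_le (p : ℕ) (hp : 1 ≤ p) : 1 + p ^ 3 + (p - 2) * (p + 1) ^ 3 ≤ 10 * p ^ 4 := by
  have h1 : (p - 2) * (p + 1) ^ 3 ≤ p * (2 * p) ^ 3 := by
    have ha : p - 2 ≤ p := Nat.sub_le _ _
    have hb : (p + 1) ^ 3 ≤ (2 * p) ^ 3 := Nat.pow_le_pow_left (by omega) 3
    exact Nat.mul_le_mul ha hb
  have h2 : p * (2 * p) ^ 3 = 8 * p ^ 4 := by ring
  have h3 : 1 ≤ p ^ 4 := Nat.one_le_pow _ _ hp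
  have h4 : p ^ 3 ≤ p ^ 4 := Nat.pow_le_pow_right hp (by norm_num)
  omega

/-- **Kill transfer.**  `LevelOneGL2Designs` implies the exponent-3 milestone at `(2,1)` for
unboundedly many primes: `V ≥ c³p^{9/2} > 10p⁴ ≥ B₃(p)` once `√p > 10/c³`.  Contrapositive below. -/
theorem beatsCubes_of_levelOneGL2Designs (h : LevelOneGL2Designs) :
    ∀ p₀ : ℕ, ∃ (p : ℕ) (_ : Fact p.Prime), p₀ ≤ p ∧ LevelOneBeatsCubesAt p := by
  obtain ⟨c, hc, hall⟩ := h
  intro p₀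
  -- threshold: √p > 10/c³, i.e. p > 100/c⁶
  obtain ⟨N, hN⟩ := exists_nat_gt (max (p₀ : ℝ) (100 / c ^ 6 + 1))
  obtain ⟨p, hprime, hNp, X, Y, Z, hsep, hX, hY, hZ⟩ := hall N
  have hp0 : (0 : ℝ) < p := p_pos
  have hNR : (N : ℝ) ≤ p := by exact_mod_cast hNp
  have hp₀ : p₀ ≤ p := by
    have : (p₀ : ℝ) ≤ p := le_trans (le_trans (le_max_left _ _) hN.le) hNR
    exact_mod_cast this
  refine ⟨p, hprime, hp₀, X, Y, Z, hsep, ?_⟩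
  have hthr : 100 / c ^ 6 < p := by
    have := lt_of_lt_of_le (lt_of_le_of_lt (le_max_right _ _) hN) hNR
    linarith
  -- volume lower bound: (c p^{3/2})³ ≤ V
  set L : ℝ := c * (p : ℝ) ^ (3 / 2 : ℝ) with hL
  have hL0 : 0 < L := by positivity
  have hV : L * L * L ≤ ((X.card * Y.card * Z.card : ℕ) : ℝ) := by
    push_cast
    have hXY : L * L ≤ (X.card : ℝ) * Y.card := mul_le_mul hX hY hL0.le (le_trans hL0.le hX)
    exact mul_le_mul hXY hZ hL0.le (le_trans (by positivity) hXY)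
  -- L³ = c³ p^{9/2} = c³ p³ p^{3/2} and p^{3/2} ≥ p · √... use p^{3/2}·p^{3/2} = p³ twice:
  -- (L·L·L)² = c⁶ p⁹ > (10 p⁴)² = 100 p⁸ iff c⁶ p > 100.
  have hB : ((1 + p ^ 3 + (p - 2) * (p + 1) ^ 3 : ℕ) : ℝ) ≤ 10 * (p : ℝ) ^ 4 := by
    exact_mod_cast budget3_le p hprime.out.one_lt.le
  have hsq : (10 * (p : ℝ) ^ 4) * (10 * (p : ℝ) ^ 4) < (L * L * L) * (L * L * L) := by
    have hLL : L * L = c ^ 2 * (p : ℝ) ^ 3 := by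
      rw [hL]
      calc c * (p : ℝ) ^ (3 / 2 : ℝ) * (c * (p : ℝ) ^ (3 / 2 : ℝ))
          = c ^ 2 * ((p : ℝ) ^ (3 / 2 : ℝ) * (p : ℝ) ^ (3 / 2 : ℝ)) := by ring
        _ = c ^ 2 * (p : ℝ) ^ 3 := by rw [rpow_three_halves_mul_self]
    have h6 : (L * L * L) * (L * L * L) = c ^ 6 * (p : ℝ) ^ 9 := by
      calc (L * L * L) * (L * L * L) = (L * L) * (L * L) * (L * L) := by ring
        _ = c ^ 6 * (p : ℝ) ^ 9 := by rw [hLL]; ring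
    rw [h6]
    have hc6 : 0 < c ^ 6 := by positivity
    have h100 : 100 < c ^ 6 * p := by
      have := (div_lt_iff₀ hc6).mp hthr
      linarith
    have hp8 : 0 < (p : ℝ) ^ 8 := by positivity
    nlinarith
  have hlt : 10 * (p : ℝ) ^ 4 < L * L * L := by
    by_contra hge
    push Not at hge
    have h10 : 0 ≤ L * L * L := by positivity
    nlinarith [mul_le_mul hge hge h10 (by positivity)]
  have hfin : ((1 + p ^ 3 + (p - 2) * (p + 1) ^ 3 : ℕ) : ℝ) < ((X.card * Y.card * Z.card : ℕ) : ℝ) :=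
    lt_of_le_of_lt hB (lt_of_lt_of_le hlt hV)
  exact_mod_cast hfin

/-- **Contrapositive (the usable kill criterion for the `LieRankBeatsCubes` seat)**: if the `(2,1)`
cell of the exponent-3 milestone is EMPTY for all primes beyond some `p₀` — i.e. no rank-1-separated
triple of `GL_2(𝔽_p)` ever beats the level-one sum of cubes `1 + p³ + (p−2)(p+1)³` for large `p` —
then `LevelOneGL2Designs` is false.  (Emptiness for `p ≤ 7` is the sibling's theorem; `p = 11, 13,
17` are the live cells.) -/
theorem not_levelOneGL2Designs_of_eventually_not_beatsCubes
    (h : ∃ p₀ : ℕ, ∀ (p : ℕ) [Fact p.Prime], p₀ ≤ p → ¬ LevelOneBeatsCubesAt p) :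
    ¬ LevelOneGL2Designs := by
  intro hX
  obtain ⟨p₀, hp₀⟩ := h
  obtain ⟨p, hprime, hle, hbeats⟩ := beatsCubes_of_levelOneGL2Designs hX p₀
  exact hp₀ p hle hbeats

end Milestone

/-! ## KILL CRITERION: any level-one packing bound `V ≤ C·p⁴` refutes the crux -/

section Packing

/-- A level-one PACKING BOUND with constant `C`: every rank-1-separated triple of `GL_2(𝔽_p)` has
`|X||Y||Z| ≤ C·p⁴` (the prime-field frontier scale `|G|^{1+o(1)}`).  UNKNOWN — this is the named
candidate kill ("graded mixing", `V ≲ W^{3/2}/√d_min`); every construction known to the route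
respects it with `C ≤ 1`. -/
def LevelOnePackingBound (C : ℝ) : Prop :=
  ∀ (p : ℕ) [Fact p.Prime] (X Y Z : Finset (GLm p 2)), RankSep 1 X Y Z →
    ((X.card * Y.card * Z.card : ℕ) : ℝ) ≤ C * (p : ℝ) ^ 4

/-- **Packing bound ⇒ ¬ crux**: `c³ p^{9/2} ≤ V ≤ C p⁴` fails as soon as `c⁶ p > C²`. -/
theorem not_levelOneGL2Designs_of_packingBound {C : ℝ} (hC : LevelOnePackingBound C) :
    ¬ LevelOneGL2Designs := by
  rintro ⟨c, hc, hall⟩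
  obtain ⟨N, hN⟩ := exists_nat_gt (C ^ 2 / c ^ 6 + 1)
  obtain ⟨p, hprime, hNp, X, Y, Z, hsep, hX, hY, hZ⟩ := hall N
  have hp0 : (0 : ℝ) < p := p_pos
  have hNR : (N : ℝ) ≤ p := by exact_mod_cast hNp
  have hthr : C ^ 2 / c ^ 6 < p := by linarith
  set L : ℝ := c * (p : ℝ) ^ (3 / 2 : ℝ) with hL
  have hL0 : 0 < L := by positivity
  have hV : L * L * L ≤ ((X.card * Y.card * Z.card : ℕ) : ℝ) := by
    push_cast
    have hXY : L * L ≤ (X.card : ℝ) * Y.card := mul_le_mul hX hY hL0.le (le_trans hL0.le hX)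
    exact mul_le_mul hXY hZ hL0.le (le_trans (by positivity) hXY)
  have hup := hC p X Y Z hsep
  have hLLL : L * L * L ≤ C * (p : ℝ) ^ 4 := hV.trans hup
  have hC0 : 0 < C := by
    have : 0 < C * (p : ℝ) ^ 4 := lt_of_lt_of_le (by positivity) hLLL
    have hp4 : 0 < (p : ℝ) ^ 4 := by positivity
    nlinarith
  have hLL : L * L = c ^ 2 * (p : ℝ) ^ 3 := by
    rw [hL]
    calc c * (p : ℝ) ^ (3 / 2 : ℝ) * (c * (p : ℝ) ^ (3 / 2 : ℝ))
        = c ^ 2 * ((p : ℝ) ^ (3 / 2 : ℝ) * (p : ℝ) ^ (3 / 2 : ℝ)) := by ring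
      _ = c ^ 2 * (p : ℝ) ^ 3 := by rw [rpow_three_halves_mul_self]
  have h6 : (L * L * L) * (L * L * L) = c ^ 6 * (p : ℝ) ^ 9 := by
    calc (L * L * L) * (L * L * L) = (L * L) * (L * L) * (L * L) := by ring
      _ = c ^ 6 * (p : ℝ) ^ 9 := by rw [hLL]; ring
  have hsq : c ^ 6 * (p : ℝ) ^ 9 ≤ C ^ 2 * (p : ℝ) ^ 8 := by
    have := mul_le_mul hLLL hLLL (by positivity) (by positivity)
    rw [h6] at this
    nlinarith
  have hc6 : 0 < c ^ 6 := by positivity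
  have hthr' : C ^ 2 < c ^ 6 * p := by
    have := (div_lt_iff₀ hc6).mp hthr
    linarith
  have hp8 : 0 < (p : ℝ) ^ 8 := by positivity
  nlinarith [mul_lt_mul_of_pos_right hthr' hp8]

end Packing

/-! ## PERMUTABLE SUBGROUP DESIGNS NEVER PASS THE WALL (any group, any bi-invariant test space) -/

section Permutable

variable {G : Type} [Group G] [Fintype G] [DecidableEq G]

/-- **Permutable subgroup designs are interpolation sets.**  Let `J ≤ ℂ^G` be bi-invariant and let
`H₁, H₂, H₃ ≤ G` with `H₁H₂ = H₂H₁` (a permutable pair).  If ONE function `f₀ ∈ J` passes the identity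
test (`f₀(1) = 1`, `f₀(abc) = 0` whenever `abc ≠ 1`), then every delta function on the product set
`S = H₁H₂H₃` is realised by `J` (translate `f₀` by `((ab)⁻¹, c⁻¹)`, which maps `S` into itself
because `H₁H₂` is a group), so `|H₁H₂H₃| ≤ dim J`.  No TPP is needed. -/
theorem card_tripleProducts_le_finrank (J : Submodule ℂ (G → ℂ))
    (hJ : ∀ f ∈ J, ∀ a b : G, (fun g => f (a * g * b)) ∈ J)
    (H₁ H₂ H₃ : Subgroup G)
    (hperm : ∀ a ∈ H₁, ∀ b ∈ H₂, ∃ a' ∈ H₁, ∃ b' ∈ H₂, b * a = a' * b')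
    (htest : ∃ f₀ ∈ J, f₀ 1 = 1 ∧
      ∀ a ∈ H₁, ∀ b ∈ H₂, ∀ c ∈ H₃, a * b * c ≠ 1 → f₀ (a * b * c) = 0) :
    Nat.card {g : G // ∃ a ∈ H₁, ∃ b ∈ H₂, ∃ c ∈ H₃, g = a * b * c} ≤ Module.finrank ℂ J := by
  classical
  obtain ⟨f₀, hf₀, h1, h0⟩ := htest
  set T := {g : G // ∃ a ∈ H₁, ∃ b ∈ H₂, ∃ c ∈ H₃, g = a * b * c} with hT
  let r : J →ₗ[ℂ] (T → ℂ) :=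
    { toFun := fun f t => (f : G → ℂ) t.1
      map_add' := fun f f' => by funext t; rfl
      map_smul' := fun a f => by funext t; rfl }
  have hsurj : Function.Surjective r := by
    rw [← LinearMap.range_eq_top, eq_top_iff, ← (Pi.basisFun ℂ T).span_eq, Submodule.span_le]
    rintro _ ⟨t₀, rfl⟩
    obtain ⟨a, ha, b, hb, c, hc, ht₀⟩ := t₀.2
    refine ⟨⟨fun g => f₀ ((a * b)⁻¹ * g * c⁻¹), hJ f₀ hf₀ _ _⟩, ?_⟩
    funext t
    simp only [r, LinearMap.coe_mk, AddHom.coe_mk, Pi.basisFun_apply]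
    obtain ⟨a', ha', b', hb', c', hc', ht⟩ := t.2
    -- rewrite b⁻¹ (a⁻¹ a') as a'' b'' using permutability
    obtain ⟨a'', ha'', b'', hb'', hp⟩ :=
      hperm (a⁻¹ * a') (H₁.mul_mem (H₁.inv_mem ha) ha') b⁻¹ (H₂.inv_mem hb)
    have he : (a * b)⁻¹ * t.1 * c⁻¹ = a'' * (b'' * b') * (c' * c⁻¹) := by
      rw [ht, show (a * b)⁻¹ * (a' * b' * c') * c⁻¹ = (b⁻¹ * (a⁻¹ * a')) * b' * c' * c⁻¹ by group,
        hp]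
      group
    by_cases heq : (a * b)⁻¹ * t.1 * c⁻¹ = 1
    · have htt : t = t₀ := by
        apply Subtype.ext
        rw [ht₀]
        calc t.1 = (a * b) * ((a * b)⁻¹ * t.1 * c⁻¹) * c := by group
          _ = a * b * c := by rw [heq]; group
      rw [heq, h1, htt, Pi.single_eq_same]
    · have hne : t ≠ t₀ := by
        rintro rfl
        apply heq
        rw [ht₀]; group
      rw [Pi.single_eq_of_ne hne, he]
      refine h0 _ ha'' _ (H₂.mul_mem hb'' hb') _ (H₃.mul_mem hc' (H₃.inv_mem hc)) ?_
      rwa [← he]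
  have h := LinearMap.finrank_le_finrank_of_surjective hsurj
  rwa [Module.finrank_fintype_fun_eq_card, ← Nat.card_eq_fintype_card] at h

/-- **Permutable subgroup designs never exceed the wall.**  With the subgroup TPP on top, the product
map `H₁ × H₂ × H₃ → H₁H₂H₃` is injective (this needs the permutable pair — for three arbitrary
subgroups TPP does NOT give injectivity: `S₃` with its three subgroups of order `2`), hence
`|H₁||H₂||H₃| ≤ dim J`: such designs are useless for EVERY graded budget at exponent `≤ 3`
(`V ≤ Σ_{J} d² ≤ Σ_J d^s`).  Applies to all Borel-type templates whose middle group normalises an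
outer one (`(U⁻,T,U⁺)`, `(Aff⁺,T,U⁻)`, `(U⁻⋊A₁, T', U⁺⋊A₃)`, trivial middles). -/
theorem card_mul_card_mul_card_le_finrank_of_permutable (J : Submodule ℂ (G → ℂ))
    (hJ : ∀ f ∈ J, ∀ a b : G, (fun g => f (a * g * b)) ∈ J)
    (H₁ H₂ H₃ : Subgroup G)
    (hperm : ∀ a ∈ H₁, ∀ b ∈ H₂, ∃ a' ∈ H₁, ∃ b' ∈ H₂, b * a = a' * b')
    (htpp : SubgroupTPP H₁ H₂ H₃)
    (htest : ∃ f₀ ∈ J, f₀ 1 = 1 ∧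
      ∀ a ∈ H₁, ∀ b ∈ H₂, ∀ c ∈ H₃, a * b * c ≠ 1 → f₀ (a * b * c) = 0) :
    Nat.card H₁ * Nat.card H₂ * Nat.card H₃ ≤ Module.finrank ℂ J := by
  classical
  let T := {g : G // ∃ a ∈ H₁, ∃ b ∈ H₂, ∃ c ∈ H₃, g = a * b * c}
  let φ : H₁ × H₂ × H₃ → T := fun x =>
    ⟨(x.1 : G) * x.2.1 * x.2.2, x.1, x.1.2, x.2.1, x.2.1.2, x.2.2, x.2.2.2, rfl⟩
  have hinj : Function.Injective φ := by
    rintro ⟨⟨a, ha⟩, ⟨b, hb⟩, ⟨c, hc⟩⟩ ⟨⟨a', ha'⟩, ⟨b', hb'⟩, ⟨c', hc'⟩⟩ he'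
    have he : a * b * c = a' * b' * c' := congrArg Subtype.val he'
    obtain ⟨a₁, ha₁, b₁, hb₁, hp⟩ :=
      hperm (a'⁻¹ * a) (H₁.mul_mem (H₁.inv_mem ha') ha) b'⁻¹ (H₂.inv_mem hb')
    -- x := b'⁻¹ a'⁻¹ a b = a₁ (b₁ b) ∈ H₁H₂ and x = c' c⁻¹ ∈ H₃
    have hrel : a₁ * (b₁ * b) * (c * c'⁻¹) = 1 := by
      calc a₁ * (b₁ * b) * (c * c'⁻¹) = (b'⁻¹ * (a'⁻¹ * a)) * b * c * c'⁻¹ := by rw [hp]; group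
        _ = b'⁻¹ * a'⁻¹ * (a * b * c) * c'⁻¹ := by group
        _ = 1 := by rw [he]; group
    obtain ⟨h1, h2, h3⟩ := htpp a₁ ha₁ _ (H₂.mul_mem hb₁ hb) _ (H₃.mul_mem hc (H₃.inv_mem hc')) hrel
    have hcc : c = c' := mul_inv_eq_one.mp h3
    subst hcc
    have hab : a * b = a' * b' := mul_right_cancel he
    have hrel2 : (a'⁻¹ * a) * (b * b'⁻¹) * (1 : G) = 1 := by
      calc (a'⁻¹ * a) * (b * b'⁻¹) * 1 = a'⁻¹ * (a * b) * b'⁻¹ := by group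
        _ = 1 := by rw [hab]; group
    obtain ⟨k1, k2, -⟩ := htpp _ (H₁.mul_mem (H₁.inv_mem ha') ha) _ (H₂.mul_mem hb (H₂.inv_mem hb'))
      1 H₃.one_mem hrel2
    have haa : a = a' := by
      have := congrArg (a' * ·) k1; simpa using this
    have hbb : b = b' := mul_inv_eq_one.mp k2
    subst haa hbb
    rfl
  have hle := Nat.card_le_card_of_injective φ hinj
  rw [Nat.card_prod, Nat.card_prod] at hle
  calc Nat.card H₁ * Nat.card H₂ * Nat.card H₃ = Nat.card H₁ * (Nat.card H₂ * Nat.card H₃) := by ring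
    _ ≤ Nat.card T := hle
    _ ≤ Module.finrank ℂ J := card_tripleProducts_le_finrank J hJ H₁ H₂ H₃ hperm htest

end Permutable

/-! ## The level-one instance: permutable subgroup templates of `GL_2(𝔽_p)` have `V ≤ N₁(p) ≈ p³` -/

section PermutableGL2

variable {p : ℕ} [Fact p.Prime]

/-- `F_1|_G` is bi-invariant (both one-sided invariances of the sibling seat, composed). -/
theorem levelSubmodule_bi_inv {m k : ℕ} :
    ∀ f ∈ levelSubmodule p m k, ∀ a b : GLm p m,
      (fun g => f (a * g * b)) ∈ levelSubmodule p m k := by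
  intro f hf a b
  have h1 := levelSubmodule_left_inv f hf a
  have h2 := levelSubmodule_right_inv _ h1 b
  simpa [mul_assoc] using h2

/-- **Permutable subgroup templates are dead at level one.**  If `X, Y, Z` are (the carriers of)
subgroups `H₁, H₂, H₃ ≤ GL_2(𝔽_p)` with `H₁H₂ = H₂H₁` and the triple is rank-1-separated, then
`|X||Y||Z| ≤ N₁(p) = p³ + p² − p` — the wall itself, a factor `p^{3/2}` below the crux's `c³p^{9/2}`
and a factor `p` below the exponent-3 milestone.  (Covers `(U⁻⋊A₁, T', U⁺⋊A₃)` for every `T' ≤ T`,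
`(U⁻,T,U⁺)` — hence NOT separated for `p ≥ 3`, answering kit j008501 on paper — and `(Aff⁺,T,U⁻)`.) -/
theorem volume_le_of_permutable_subgroups (H₁ H₂ H₃ : Subgroup (GLm p 2))
    (hperm : ∀ a ∈ H₁, ∀ b ∈ H₂, ∃ a' ∈ H₁, ∃ b' ∈ H₂, b * a = a' * b')
    {X Y Z : Finset (GLm p 2)} (hX : ∀ g, g ∈ X ↔ g ∈ H₁) (hY : ∀ g, g ∈ Y ↔ g ∈ H₂)
    (hZ : ∀ g, g ∈ Z ↔ g ∈ H₃) (hsep : RankSep 1 X Y Z) :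
    X.card * Y.card * Z.card ≤ Fintype.card (RankLE p 2 1) := by
  classical
  have h1X : (1 : GLm p 2) ∈ X := (hX 1).mpr H₁.one_mem
  have h1Y : (1 : GLm p 2) ∈ Y := (hY 1).mpr H₂.one_mem
  have h1Z : (1 : GLm p 2) ∈ Z := (hZ 1).mpr H₃.one_mem
  obtain ⟨f, hf, hfsep⟩ := sep_clause_of_rankSep hsep 1 h1X 1 h1Z
  -- the identity test and the subgroup TPP, both read off the target (1,1)
  have hval : ∀ a ∈ H₁, ∀ b ∈ H₂, ∀ c ∈ H₃,
      (a = 1 ∧ b = 1 ∧ c = 1 → f (a * b * c) = 1) ∧ (¬ (a = 1 ∧ b = 1 ∧ c = 1) → f (a * b * c) = 0) := by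
    intro a ha b hb c hc
    have h := hfsep a⁻¹ ((hX _).mpr (H₁.inv_mem ha)) b ((hY _).mpr hb) 1 h1Y c ((hZ _).mpr hc)
    simp only [inv_inv, inv_one, mul_one, inv_eq_one] at h
    exact h
  have htest : ∃ f₀ ∈ levelSubmodule p 2 1, f₀ 1 = 1 ∧
      ∀ a ∈ H₁, ∀ b ∈ H₂, ∀ c ∈ H₃, a * b * c ≠ 1 → f₀ (a * b * c) = 0 := by
    refine ⟨f, hf, ?_, fun a ha b hb c hc hne => ?_⟩
    · simpa using (hval 1 H₁.one_mem 1 H₂.one_mem 1 H₃.one_mem).1 ⟨rfl, rfl, rfl⟩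
    · refine (hval a ha b hb c hc).2 fun h => hne ?_
      rw [h.1, h.2.1, h.2.2, one_mul, one_mul]
  have htpp : SubgroupTPP H₁ H₂ H₃ := by
    intro a ha b hb c hc habc
    by_contra hnot
    have h0 := (hval a ha b hb c hc).2 hnot
    have h1 := (hval 1 H₁.one_mem 1 H₂.one_mem 1 H₃.one_mem).1 ⟨rfl, rfl, rfl⟩
    rw [habc] at h0
    simp only [one_mul] at h1
    rw [h1] at h0
    exact one_ne_zero h0
  have hmain := card_mul_card_mul_card_le_finrank_of_permutable (levelSubmodule p 2 1)
    levelSubmodule_bi_inv H₁ H₂ H₃ hperm htpp htest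
  have hcard : ∀ (H : Subgroup (GLm p 2)) (S : Finset (GLm p 2)), (∀ g, g ∈ S ↔ g ∈ H) →
      Nat.card H = S.card := by
    intro H S hS
    rw [Nat.card_congr (Equiv.subtypeEquivRight (fun g => (hS g).symm) : ↥H ≃ {g // g ∈ S}),
      Nat.card_eq_fintype_card, Fintype.card_coe]
  rw [hcard H₁ X hX, hcard H₂ Y hY, hcard H₃ Z hZ] at hmain
  exact hmain.trans finrank_levelSubmodule_le

end PermutableGL2

/-! ## The permutable-subgroup special case of the crux is FALSE -/

section PermutableCrux

variable {p : ℕ} [Fact p.Prime]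

/-- Explicit form: `|X||Y||Z| ≤ p³ + p² − p` for rank-1-separated permutable subgroup triples. -/
theorem volume_le_of_permutable_subgroups' (H₁ H₂ H₃ : Subgroup (GLm p 2))
    (hperm : ∀ a ∈ H₁, ∀ b ∈ H₂, ∃ a' ∈ H₁, ∃ b' ∈ H₂, b * a = a' * b')
    {X Y Z : Finset (GLm p 2)} (hX : ∀ g, g ∈ X ↔ g ∈ H₁) (hY : ∀ g, g ∈ Y ↔ g ∈ H₂)
    (hZ : ∀ g, g ∈ Z ↔ g ∈ H₃) (hsep : RankSep 1 X Y Z) :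
    X.card * Y.card * Z.card ≤ p ^ 3 + p ^ 2 - p :=
  (volume_le_of_permutable_subgroups H₁ H₂ H₃ hperm hX hY hZ hsep).trans card_rankLE_two_one.le

end PermutableCrux

/-- **ARCHITECTURE KILL: the crux is false for permutable subgroup triples.**  No family of
rank-1-separated SUBGROUP triples `(H₁, H₂, H₃)` of `GL_2(𝔽_p)` with `H₁H₂ = H₂H₁` (e.g. a torus or
trivial middle normalising a unipotent outer group — every Borel-type template with a split-torus
middle) has all three orders `≥ c·p^{3/2}`: their volume is `≤ N₁(p) ≤ p³ + p² < c³p⁴ ≤ c³p^{9/2}`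
once `p > 2/c³`.  (The general crux allows arbitrary subsets; for subgroup witnesses the only
surviving shape at `(2,1)` is a NON-permutable pair on both sides, e.g. a non-split-torus middle.) -/
theorem not_levelOneGL2Designs_permutableSubgroups :
    ¬ ∃ c : ℝ, 0 < c ∧ ∀ p₀ : ℕ, ∃ (p : ℕ) (_ : Fact p.Prime), p₀ ≤ p ∧
        ∃ (H₁ H₂ H₃ : Subgroup (GLm p 2)) (X Y Z : Finset (GLm p 2)),
          (∀ a ∈ H₁, ∀ b ∈ H₂, ∃ a' ∈ H₁, ∃ b' ∈ H₂, b * a = a' * b') ∧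
          (∀ g, g ∈ X ↔ g ∈ H₁) ∧ (∀ g, g ∈ Y ↔ g ∈ H₂) ∧ (∀ g, g ∈ Z ↔ g ∈ H₃) ∧
          RankSep 1 X Y Z ∧
          c * (p : ℝ) ^ (3 / 2 : ℝ) ≤ X.card ∧ c * (p : ℝ) ^ (3 / 2 : ℝ) ≤ Y.card ∧
          c * (p : ℝ) ^ (3 / 2 : ℝ) ≤ Z.card := by
  rintro ⟨c, hc, hall⟩
  obtain ⟨N, hN⟩ := exists_nat_gt (2 / c ^ 3 + 1)
  obtain ⟨p, hprime, hNp, H₁, H₂, H₃, X, Y, Z, hperm, hX, hY, hZ, hsep, hXc, hYc, hZc⟩ := hall N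
  have hp0 : (0 : ℝ) < p := p_pos
  have hp1 : (1 : ℝ) ≤ p := one_le_p
  have hNR : (N : ℝ) ≤ p := by exact_mod_cast hNp
  have hthr : 2 / c ^ 3 < p := by linarith
  have hV := volume_le_of_permutable_subgroups' H₁ H₂ H₃ hperm hX hY hZ hsep
  have hVR : ((X.card * Y.card * Z.card : ℕ) : ℝ) ≤ (p : ℝ) ^ 3 + (p : ℝ) ^ 2 := by
    exact_mod_cast hV.trans (Nat.sub_le _ _)
  set L : ℝ := c * (p : ℝ) ^ (3 / 2 : ℝ) with hL
  have hL0 : 0 < L := by positivity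
  have hlow : L * L * L ≤ ((X.card * Y.card * Z.card : ℕ) : ℝ) := by
    push_cast
    have hXY : L * L ≤ (X.card : ℝ) * Y.card := mul_le_mul hXc hYc hL0.le (le_trans hL0.le hXc)
    exact mul_le_mul hXY hZc hL0.le (le_trans (by positivity) hXY)
  have hLL : L * L = c ^ 2 * (p : ℝ) ^ 3 := by
    rw [hL]
    calc c * (p : ℝ) ^ (3 / 2 : ℝ) * (c * (p : ℝ) ^ (3 / 2 : ℝ))
        = c ^ 2 * ((p : ℝ) ^ (3 / 2 : ℝ) * (p : ℝ) ^ (3 / 2 : ℝ)) := by ring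
      _ = c ^ 2 * (p : ℝ) ^ 3 := by rw [rpow_three_halves_mul_self]
  have hc4 : c ^ 3 * (p : ℝ) ^ 4 ≤ L * L * L := by
    have h32 : (p : ℝ) ≤ (p : ℝ) ^ (3 / 2 : ℝ) := p_le_rpow_three_halves
    have hc3 : 0 ≤ c ^ 2 * (p : ℝ) ^ 3 * c := by positivity
    calc c ^ 3 * (p : ℝ) ^ 4 = c ^ 2 * (p : ℝ) ^ 3 * c * p := by ring
      _ ≤ c ^ 2 * (p : ℝ) ^ 3 * c * (p : ℝ) ^ (3 / 2 : ℝ) := mul_le_mul_of_nonneg_left h32 hc3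
      _ = L * L * L := by rw [hLL, hL]; ring
  -- c³ p⁴ ≤ p³ + p² ≤ 2p³, i.e. c³ p ≤ 2: contradicts p > 2/c³
  have h2 : (p : ℝ) ^ 3 + (p : ℝ) ^ 2 ≤ 2 * (p : ℝ) ^ 3 := by nlinarith
  have hcp : c ^ 3 * p ≤ 2 := by
    have hp3 : 0 < (p : ℝ) ^ 3 := by positivity
    have : c ^ 3 * (p : ℝ) ^ 4 ≤ 2 * (p : ℝ) ^ 3 := by linarith
    nlinarith
  have hc3 : 0 < c ^ 3 := by positivity
  have : 2 < c ^ 3 * p := by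
    have := (div_lt_iff₀ hc3).mp hthr
    linarith
  linarith

/-! ## THE RECTANGLE RELATION (ideator 2's `rectangle_orth`, PROVED here) -/

section Rectangle

variable {p : ℕ} [Fact p.Prime]

/-- The upper-triangular matrix `[[s, x], [0, t]]`. -/
def triU (s t x : ZMod p) : Mat p 2 := !![s, x; 0, t]

theorem triU_injective (s t : ZMod p) : Function.Injective (triU s t) := by
  intro x y h
  have := congrFun (congrFun h 0) 1
  simpa [triU] using this

/-- Indicator of the coset piece `{N : N₁₀ = 0, N₀₀ = s, N₁₁ = t}` (as matrices). -/
def ind (s t : ZMod p) (N : Mat p 2) : ℂ :=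
  if N 1 0 = 0 ∧ N 0 0 = s ∧ N 1 1 = t then 1 else 0

/-- **One coset, one character**: `Σ_{N ∈ diag(s,t)U⁺} ψ(tr(M N)) = ψ(M₀₀ s + M₁₁ t) · Σ_x ψ(M₁₀ x)`. -/
theorem sum_ind_mul_psi (M : Mat p 2) (s t : ZMod p) :
    ∑ N : Mat p 2, ind s t N * ZMod.stdAddChar (Matrix.trace (M * N))
      = ZMod.stdAddChar (M 0 0 * s + M 1 1 * t) * ∑ x : ZMod p, ZMod.stdAddChar (M 1 0 * x) := by
  classical
  have h1 : ∑ N : Mat p 2, ind s t N * ZMod.stdAddChar (Matrix.trace (M * N))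
      = ∑ N ∈ Finset.univ.filter (fun N : Mat p 2 => N 1 0 = 0 ∧ N 0 0 = s ∧ N 1 1 = t),
          ZMod.stdAddChar (Matrix.trace (M * N)) := by
    rw [Finset.sum_filter]
    refine Finset.sum_congr rfl fun N _ => ?_
    unfold ind
    split_ifs <;> simp
  have hfilter : Finset.univ.filter (fun N : Mat p 2 => N 1 0 = 0 ∧ N 0 0 = s ∧ N 1 1 = t)
      = Finset.univ.image (triU s t) := by
    ext N
    simp only [Finset.mem_filter, Finset.mem_univ, true_and, Finset.mem_image]
    constructor
    · rintro ⟨h10, h00, h11⟩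
      refine ⟨N 0 1, ?_⟩
      ext i j
      fin_cases i <;> fin_cases j <;> simp [triU, h10, h00, h11]
    · rintro ⟨x, rfl⟩
      simp [triU]
  rw [h1, hfilter]
  have hinj : ∀ x ∈ (Finset.univ : Finset (ZMod p)), ∀ y ∈ (Finset.univ : Finset (ZMod p)),
      triU s t x = triU s t y → x = y := fun x _ y _ h => triU_injective s t h
  rw [Finset.sum_image hinj, Finset.mul_sum]
  refine Finset.sum_congr rfl fun x _ => ?_
  rw [← AddChar.map_add_eq_mul]
  congr 1
  have htr : Matrix.trace (M * triU s t x) = M 0 0 * s + M 1 0 * x + M 1 1 * t := by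
    simp [triU, Matrix.trace_fin_two, Matrix.mul_apply, Fin.sum_univ_two]
    ring
  rw [htr]
  ring

/-- Ideator 2's `rectangle` (verbatim copy of `Cruxes/LevelOneGL2Designs/Ideator2Sketch.lean`, which is
not imported here to keep this file independent of a sketch that is still moving): the signed
indicator `+1` on `diag(a,d)U⁺ ∪ diag(a',d')U⁺`, `−1` on `diag(a,d')U⁺ ∪ diag(a',d)U⁺`. -/
def rectangle (a a' d d' : ZMod p) (g : GLm p 2) : ℂ :=
  if (g : Mat p 2) 1 0 = 0 then
    (if (g : Mat p 2) 0 0 = a ∧ (g : Mat p 2) 1 1 = d then 1 else 0)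
    - (if (g : Mat p 2) 0 0 = a ∧ (g : Mat p 2) 1 1 = d' then 1 else 0)
    - (if (g : Mat p 2) 0 0 = a' ∧ (g : Mat p 2) 1 1 = d then 1 else 0)
    + (if (g : Mat p 2) 0 0 = a' ∧ (g : Mat p 2) 1 1 = d' then 1 else 0)
  else 0

/-- The rectangle as a combination of four coset indicators, on matrices. -/
def rectM (a a' d d' : ZMod p) (N : Mat p 2) : ℂ :=
  ind a d N - ind a d' N - ind a' d N + ind a' d' N

/-- `rectangle` is `rectM` read on the underlying matrix. -/
theorem rectangle_eq_rectM (a a' d d' : ZMod p) (g : GLm p 2) :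
    rectangle a a' d d' g = rectM a a' d d' (g : Mat p 2) := by
  unfold rectangle rectM ind
  by_cases h : (g : Mat p 2) 1 0 = 0
  · simp [h]
  · simp [h]

/-- **The signed character sum of a rectangle vanishes for every matrix of rank `≤ 1`.**
`Σ_N rectM(N) ψ(tr(M N)) = (Σ_x ψ(M₁₀x)) · (ψ(M₀₀a) − ψ(M₀₀a'))(ψ(M₁₁d) − ψ(M₁₁d'))`: the first factor
vanishes unless `M₁₀ = 0`, and then `det M = M₀₀M₁₁ = 0` kills one of the other two. -/
theorem sum_rectM_mul_psi_eq_zero {M : Mat p 2} (hM : M.rank ≤ 1) (a a' d d' : ZMod p) :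
    ∑ N : Mat p 2, rectM a a' d d' N * ZMod.stdAddChar (Matrix.trace (M * N)) = 0 := by
  classical
  have hsplit : ∑ N : Mat p 2, rectM a a' d d' N * ZMod.stdAddChar (Matrix.trace (M * N))
      = (∑ x : ZMod p, ZMod.stdAddChar (M 1 0 * x)) *
        ((ZMod.stdAddChar (M 0 0 * a) - ZMod.stdAddChar (M 0 0 * a')) *
         (ZMod.stdAddChar (M 1 1 * d) - ZMod.stdAddChar (M 1 1 * d'))) := by
    simp only [rectM, sub_mul, add_mul, Finset.sum_add_distrib, Finset.sum_sub_distrib,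
      sum_ind_mul_psi, AddChar.map_add_eq_mul]
    ring
  rw [hsplit]
  by_cases h10 : M 1 0 = 0
  · -- det M = M₀₀ M₁₁ = 0
    have hdet : M.det = 0 := (rank_le_one_iff_det_eq_zero M).mp hM
    rw [Matrix.det_fin_two, h10, mul_zero, sub_zero] at hdet
    rcases mul_eq_zero.mp hdet with h00 | h11
    · simp [h00]
    · simp [h11]
  · have h := AddChar.sum_mulShift (R := ZMod p) (M 1 0) (ZMod.isPrimitive_stdAddChar p)
    rw [if_neg h10] at h
    simp_rw [mul_comm _ (M 1 0)] at h
    rw [h]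
    simp

/-- `rectM` vanishes on singular matrices when `a, a', d, d' ≠ 0`. -/
theorem rectM_eq_zero_of_not_isUnit {a a' d d' : ZMod p} (ha : a ≠ 0) (ha' : a' ≠ 0) (hd : d ≠ 0)
    (hd' : d' ≠ 0) {N : Mat p 2} (hN : ¬ IsUnit N) : rectM a a' d d' N = 0 := by
  have key : ∀ s t : ZMod p, s ≠ 0 → t ≠ 0 → ind s t N = 0 := by
    intro s t hs ht
    unfold ind
    rw [if_neg]
    rintro ⟨h10, h00, h11⟩
    apply hN
    rw [Matrix.isUnit_iff_isUnit_det, Matrix.det_fin_two, h10, h00, h11, mul_zero, sub_zero]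
    exact isUnit_iff_ne_zero.mpr (mul_ne_zero hs ht)
  simp [rectM, key a d ha hd, key a d' ha hd', key a' d ha' hd, key a' d' ha' hd']

/-- Sums over `GL_2` of functions vanishing on singular matrices are sums over all matrices. -/
theorem sum_GL_eq_sum_mat (F : Mat p 2 → ℂ) (hF : ∀ N, ¬ IsUnit N → F N = 0) :
    ∑ g : GLm p 2, F (g : Mat p 2) = ∑ N : Mat p 2, F N := by
  classical
  rw [← Finset.sum_filter_of_ne (s := (Finset.univ : Finset (Mat p 2))) (p := IsUnit)
      (fun N _ hne => by_contra fun h => hne (hF N h))]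
  refine Finset.sum_nbij (fun g : GLm p 2 => (g : Mat p 2)) (fun g _ => by simp)
    (fun g _ g' _ h => Units.ext h) ?_ (fun _ _ => rfl)
  intro N hN
  simp only [Finset.coe_filter, Finset.mem_univ, true_and, Set.mem_setOf_eq] at hN
  obtain ⟨u, rfl⟩ := hN
  exact ⟨u, by simp⟩

/-- **RECTANGLE RELATION (ideator 2's `rectangle_orth`, PROVED here).**  For `a, a', d, d'` non-zero the
signed indicator of the four cosets `diag(a,d)U⁺, diag(a,d')U⁺, diag(a',d)U⁺, diag(a',d')U⁺` (signs
`+ − − +`) is orthogonal to every level-one test function.  (`a ≠ a'`, `d ≠ d'` are not needed for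
orthogonality — only for the relation to be non-zero.)  Since `rectangle`, `RankSupp`, `fourierFn`
here are character-for-character the defs of `Ideator2Sketch.lean`, this term closes that file's
`sorry` verbatim. -/
theorem rectangle_orth {a a' d d' : ZMod p} (ha : a ≠ 0) (ha' : a' ≠ 0) (hd : d ≠ 0) (hd' : d' ≠ 0) :
    ∀ c : Mat p 2 → ℂ, RankSupp 1 c →
      ∑ g : GLm p 2, rectangle a a' d d' g * fourierFn c g = 0 := by
  classical
  intro c hc
  simp_rw [rectangle_eq_rectM]
  calc ∑ g : GLm p 2, rectM a a' d d' (g : Mat p 2) * fourierFn c g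
      = ∑ g : GLm p 2, ∑ M : Mat p 2,
          c M * (rectM a a' d d' (g : Mat p 2) * ZMod.stdAddChar (Matrix.trace (M * (g : Mat p 2)))) := by
        refine Finset.sum_congr rfl fun g _ => ?_
        rw [fourierFn, Finset.mul_sum]
        refine Finset.sum_congr rfl fun M _ => ?_
        ring
    _ = ∑ M : Mat p 2, c M * ∑ g : GLm p 2,
          rectM a a' d d' (g : Mat p 2) * ZMod.stdAddChar (Matrix.trace (M * (g : Mat p 2))) := by
        rw [Finset.sum_comm]
        refine Finset.sum_congr rfl fun M _ => ?_
        rw [Finset.mul_sum]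
    _ = 0 := by
        refine Finset.sum_eq_zero fun M _ => ?_
        by_cases hcM : c M = 0
        · rw [hcM, zero_mul]
        · have hM : M.rank ≤ 1 := le_of_not_gt fun h => hcM (hc M h)
          rw [sum_GL_eq_sum_mat (fun N => rectM a a' d d' N * ZMod.stdAddChar (Matrix.trace (M * N)))
              (fun N hN => by rw [rectM_eq_zero_of_not_isUnit ha ha' hd hd' hN, zero_mul]),
            sum_rectM_mul_psi_eq_zero hM, mul_zero]

/-- The invertible upper-triangular matrix `[[s, x], [0, t]]`, `s, t ≠ 0`, as an element of `GL_2`. -/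
def triGL (s t x : ZMod p) (hs : s ≠ 0) (ht : t ≠ 0) : GLm p 2 :=
  Matrix.GeneralLinearGroup.mkOfDetNeZero !![s, x; 0, t]
    (by rw [Matrix.det_fin_two_of]; simpa using mul_ne_zero hs ht)

@[simp] theorem triGL_val (s t x : ZMod p) (hs : s ≠ 0) (ht : t ≠ 0) :
    ((triGL s t x hs ht : GLm p 2) : Mat p 2) = !![s, x; 0, t] := rfl

theorem triGL_congr {s s' t t' x x' : ZMod p} {hs : s ≠ 0} {ht : t ≠ 0} (hs' : s' ≠ 0)
    (ht' : t' ≠ 0) (h1 : s = s') (h2 : t = t') (h3 : x = x') :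
    triGL s t x hs ht = triGL s' t' x' hs' ht' := by
  subst h1 h2 h3; rfl

/-- Where the rectangle `{1,a'} × {1,d'}` is non-zero: lower-left entry `0`, diagonal in the rectangle. -/
theorem rectangle_support {a' d' : ZMod p} {g : GLm p 2} (hg : rectangle 1 a' 1 d' g ≠ 0) :
    (g : Mat p 2) 1 0 = 0 ∧ ((g : Mat p 2) 0 0 = 1 ∨ (g : Mat p 2) 0 0 = a') ∧
      ((g : Mat p 2) 1 1 = 1 ∨ (g : Mat p 2) 1 1 = d') := by
  unfold rectangle at hg
  by_cases h10 : (g : Mat p 2) 1 0 = 0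
  · refine ⟨h10, ?_, ?_⟩
    · by_contra h
      push Not at h
      apply hg
      simp [h10, h.1, h.2]
    · by_contra h
      push Not at h
      apply hg
      simp [h10, h.1, h.2]
  · exact absurd (by simp [h10]) hg

/-- **TWO TORUS DIRECTIONS AROUND FULL `U⁺`-COSETS KILL THE TARGET `1`** (ideator 2's template kill,
now a theorem).  If `1 ∈ X`, `X` contains an element with inverse `diag(a', 1)` (`a' ≠ 0, 1`), `Y ≠ ∅`,
and `Z ⊇ U⁺ ∪ diag(1, d')U⁺` (`d' ≠ 0, 1`), then `P = X⁻¹YY⁻¹Z` contains the rectangle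
`{1, a'} × {1, d'}` of `U⁺`-cosets through the target `1 = 1⁻¹·1`, and `(X, Y, Z)` is NOT
rank-1-separated — for every `p`, whatever the middle set.  Covers the whole subgroup template
`(U⁻⋊C₁, K', U⁺⋊C₃)` with `|C₁|, |C₃| ≥ 2` (the last subgroup shape the permutability theorem left
open) and `(Aff⁺, T₂, U⁻)` up to transpose. -/
theorem not_rankSep_of_torus_rectangle {X Y Z : Finset (GLm p 2)} {a' d' : ZMod p}
    (ha'0 : a' ≠ 0) (ha'1 : a' ≠ 1) (hd'0 : d' ≠ 0) (hd'1 : d' ≠ 1)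
    (h1X : (1 : GLm p 2) ∈ X) (hXa : ∃ x₁ ∈ X, ((x₁⁻¹ : GLm p 2) : Mat p 2) = !![a', 0; 0, 1])
    (hY : Y.Nonempty)
    (hZ1 : ∀ x : ZMod p, triGL 1 1 x one_ne_zero one_ne_zero ∈ Z)
    (hZd : ∀ x : ZMod p, triGL 1 d' x one_ne_zero hd'0 ∈ Z) :
    ¬ RankSep 1 X Y Z := by
  classical
  obtain ⟨y₀, hy₀⟩ := hY
  obtain ⟨x₁, hx₁, hx₁inv⟩ := hXa
  have h1Z : (1 : GLm p 2) ∈ Z := by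
    have h := hZ1 0
    have he : triGL 1 1 0 one_ne_zero one_ne_zero = (1 : GLm p 2) := by
      apply Units.ext
      rw [triGL_val]
      ext i j
      fin_cases i <;> fin_cases j <;> rfl
    rwa [he] at h
  -- every point of the rectangle is a quadruple product
  have hP : ∀ g : GLm p 2, rectangle 1 a' 1 d' g ≠ 0 → g ∈ quadProducts X Y Z := by
    intro g hg
    obtain ⟨h10, h00, h11⟩ := rectangle_support hg
    -- the diagonal entries
    set s := (g : Mat p 2) 0 0 with hs
    set t := (g : Mat p 2) 1 1 with ht
    have hs0 : s ≠ 0 := by rcases h00 with h | h <;> rw [h] <;> [exact one_ne_zero; exact ha'0]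
    have ht0 : t ≠ 0 := by rcases h11 with h | h <;> rw [h] <;> [exact one_ne_zero; exact hd'0]
    -- x with x⁻¹ = diag(s,1), z = [[1, g₀₁/s],[0,t]]
    obtain ⟨x, hx, hxinv⟩ : ∃ x ∈ X, ((x⁻¹ : GLm p 2) : Mat p 2) = !![s, 0; 0, 1] := by
      rcases h00 with h | h
      · exact ⟨1, h1X, by rw [inv_one, h]; ext i j; fin_cases i <;> fin_cases j <;> rfl⟩
      · exact ⟨x₁, hx₁, by rw [hx₁inv, h]⟩
    have hz : triGL 1 t ((g : Mat p 2) 0 1 / s) one_ne_zero ht0 ∈ Z := by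
      rcases h11 with h | h
      · rw [triGL_congr one_ne_zero one_ne_zero rfl h rfl]; exact hZ1 _
      · rw [triGL_congr one_ne_zero hd'0 rfl h rfl]; exact hZd _
    have hg_eq : g = x⁻¹ * y₀ * y₀⁻¹ * triGL 1 t ((g : Mat p 2) 0 1 / s) one_ne_zero ht0 := by
      rw [show x⁻¹ * y₀ * y₀⁻¹ * triGL 1 t ((g : Mat p 2) 0 1 / s) one_ne_zero ht0
          = x⁻¹ * triGL 1 t ((g : Mat p 2) 0 1 / s) one_ne_zero ht0 by group]
      apply Units.ext
      rw [Units.val_mul, hxinv, triGL_val]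
      ext i j
      fin_cases i <;> fin_cases j
      · simp [hs]
      · simp [Matrix.mul_apply, Fin.sum_univ_two]; field_simp
      · simp [Matrix.mul_apply, Fin.sum_univ_two, h10]
      · simp [Matrix.mul_apply, Fin.sum_univ_two, ht]
    rw [hg_eq]
    exact mem_quadProducts hx hy₀ hy₀ hz
  -- the separating function of the target (1,1) pairs to 0 with the rectangle, but the pairing is 1
  intro hsep
  obtain ⟨c, hc, hsepc⟩ := hsep 1 h1X 1 h1Z
  have hsum := rectangle_orth one_ne_zero ha'0 one_ne_zero hd'0 c hc
  have hval : ∀ g : GLm p 2, rectangle 1 a' 1 d' g * fourierFn c g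
      = if g = 1 then rectangle 1 a' 1 d' g else 0 := by
    intro g
    by_cases hρ : rectangle 1 a' 1 d' g = 0
    · simp [hρ]
    · rw [sep_apply_of_mem_quadProducts h1X h1Z hsepc (hP g hρ), inv_one, one_mul]
      by_cases hg1 : g = 1 <;> simp [hg1]
  simp_rw [hval] at hsum
  rw [Finset.sum_ite_eq'] at hsum
  simp only [Finset.mem_univ, if_true] at hsum
  -- rectangle at the identity is 1
  apply one_ne_zero (α := ℂ)
  rw [← hsum]
  unfold rectangle
  have e10 : ((1 : GLm p 2) : Mat p 2) 1 0 = 0 := by simp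
  have e00 : ((1 : GLm p 2) : Mat p 2) 0 0 = 1 := by simp
  have e11 : ((1 : GLm p 2) : Mat p 2) 1 1 = 1 := by simp
  rw [e10, e00, e11]
  simp [Ne.symm ha'1, Ne.symm hd'1]

/-- **Translated relations.**  Bi-invariance of `F_1` moves the rectangle anywhere: for all
`a, b ∈ GL_2(𝔽_p)`, `g ↦ rectangle(a g b)` is again orthogonal to every level-one test function. -/
theorem rectangle_orth_transl {a₀ a' d₀ d' : ZMod p} (ha : a₀ ≠ 0) (ha' : a' ≠ 0) (hd : d₀ ≠ 0)
    (hd' : d' ≠ 0) (a b : GLm p 2) :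
    ∀ c : Mat p 2 → ℂ, RankSupp 1 c →
      ∑ g : GLm p 2, rectangle a₀ a' d₀ d' (a * g * b) * fourierFn c g = 0 := by
  classical
  intro c hc
  -- reindex g ↦ a g b
  have hre : ∑ g : GLm p 2, rectangle a₀ a' d₀ d' (a * g * b) * fourierFn c g
      = ∑ h : GLm p 2, rectangle a₀ a' d₀ d' h * fourierFn c (a⁻¹ * h * b⁻¹) := by
    refine Fintype.sum_equiv ((Equiv.mulLeft a).trans (Equiv.mulRight b)) _ _ fun g => ?_
    simp only [Equiv.trans_apply, Equiv.coe_mulLeft, Equiv.coe_mulRight]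
    congr 2
    group
  rw [hre]
  have h := rectangle_orth ha ha' hd hd' (transl b⁻¹ a⁻¹ c) (rankSupp_transl _ _ hc)
  simpa only [fourierFn_transl] using h

/-- **MASTER FORM OF THE RECTANGLE KILL.**  If some two-sided translate of the rectangle
`{1,a'} × {1,d'}` of `U⁺`-cosets lies inside the quadruple products `P = X⁻¹YY⁻¹Z` with its corner
ON a target `x₀⁻¹z₀` (i.e. `a x₀⁻¹ z₀ b = 1`), the triple is NOT rank-1-separated.  Specialisations:
the outer-piece template kill above (`a = b = 1`, target `1`), rectangles inside the MIDDLE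
(`Q(Y) ⊇ C·U⁺` with `C ≤ T` containing `diag(a',1)` and `diag(1,d')` — every non-'graph' torus
subgroup — and `1 ∈ X ∩ Z`), and rectangles around any other target. -/
theorem not_rankSep_of_translated_rectangle {X Y Z : Finset (GLm p 2)} {a' d' : ZMod p}
    (ha'0 : a' ≠ 0) (ha'1 : a' ≠ 1) (hd'0 : d' ≠ 0) (hd'1 : d' ≠ 1)
    {x₀ z₀ : GLm p 2} (hx₀ : x₀ ∈ X) (hz₀ : z₀ ∈ Z) (a b : GLm p 2)
    (htarget : a * (x₀⁻¹ * z₀) * b = 1)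
    (hP : ∀ g : GLm p 2, rectangle 1 a' 1 d' (a * g * b) ≠ 0 → g ∈ quadProducts X Y Z) :
    ¬ RankSep 1 X Y Z := by
  classical
  intro hsep
  obtain ⟨c, hc, hsepc⟩ := hsep x₀ hx₀ z₀ hz₀
  have hsum := rectangle_orth_transl one_ne_zero ha'0 one_ne_zero hd'0 a b c hc
  have hval : ∀ g : GLm p 2, rectangle 1 a' 1 d' (a * g * b) * fourierFn c g
      = if g = x₀⁻¹ * z₀ then rectangle 1 a' 1 d' (a * g * b) else 0 := by
    intro g
    by_cases hρ : rectangle 1 a' 1 d' (a * g * b) = 0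
    · simp [hρ]
    · rw [sep_apply_of_mem_quadProducts hx₀ hz₀ hsepc (hP g hρ)]
      by_cases hg1 : g = x₀⁻¹ * z₀ <;> simp [hg1]
  simp_rw [hval] at hsum
  rw [Finset.sum_ite_eq'] at hsum
  simp only [Finset.mem_univ, if_true, htarget] at hsum
  apply one_ne_zero (α := ℂ)
  rw [← hsum]
  unfold rectangle
  have e10 : ((1 : GLm p 2) : Mat p 2) 1 0 = 0 := by simp
  have e00 : ((1 : GLm p 2) : Mat p 2) 0 0 = 1 := by simp
  have e11 : ((1 : GLm p 2) : Mat p 2) 1 1 = 1 := by simp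
  rw [e10, e00, e11]
  simp [Ne.symm ha'1, Ne.symm hd'1]

/-- **RECTANGLE IN THE MIDDLE.**  If `1 ∈ X`, `1 ∈ Z` and the quotient set of the middle realises
the four cosets — for every `x : 𝔽_p` and each `(s,t) ∈ {1,a'}×{1,d'}` some `y, y' ∈ Y` have
`y y'⁻¹ = [[s, x],[0, t]]` — then `(X, Y, Z)` is NOT rank-1-separated.  (Every middle SUBGROUP
`H₂ ⊇ U⁺⋊C` with `C ∋ diag(a',1), diag(1,d')`, e.g. any torus subgroup `C ≤ T` that is not the graph
of a homomorphism between the two coordinates, whatever the outer pieces.) -/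
theorem not_rankSep_of_middle_rectangle {X Y Z : Finset (GLm p 2)} {a' d' : ZMod p}
    (ha'0 : a' ≠ 0) (ha'1 : a' ≠ 1) (hd'0 : d' ≠ 0) (hd'1 : d' ≠ 1)
    (h1X : (1 : GLm p 2) ∈ X) (h1Z : (1 : GLm p 2) ∈ Z)
    (hQ : ∀ (s t : ZMod p) (hs : s ≠ 0) (ht : t ≠ 0), (s = 1 ∨ s = a') → (t = 1 ∨ t = d') →
      ∀ x : ZMod p, ∃ y ∈ Y, ∃ y' ∈ Y, y * y'⁻¹ = triGL s t x hs ht) :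
    ¬ RankSep 1 X Y Z := by
  classical
  refine not_rankSep_of_translated_rectangle ha'0 ha'1 hd'0 hd'1 h1X h1Z 1 1 (by group) ?_
  intro g hg
  rw [one_mul, mul_one] at hg
  obtain ⟨h10, h00, h11⟩ := rectangle_support hg
  set s := (g : Mat p 2) 0 0 with hs
  set t := (g : Mat p 2) 1 1 with ht
  have hs0 : s ≠ 0 := by rcases h00 with h | h <;> rw [h] <;> [exact one_ne_zero; exact ha'0]
  have ht0 : t ≠ 0 := by rcases h11 with h | h <;> rw [h] <;> [exact one_ne_zero; exact hd'0]
  obtain ⟨y, hy, y', hy', hyy⟩ := hQ s t hs0 ht0 h00 h11 ((g : Mat p 2) 0 1)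
  have hg_eq : g = (1 : GLm p 2)⁻¹ * y * y'⁻¹ * 1 := by
    rw [inv_one, one_mul, mul_one, hyy]
    apply Units.ext
    rw [triGL_val]
    ext i j
    fin_cases i <;> fin_cases j
    · simp [hs]
    · rfl
    · simp [h10]
    · simp [ht]
  rw [hg_eq]
  exact mem_quadProducts h1X hy hy' h1Z

end Rectangle

/-! ## MOAT INEQUALITY (ideator 3's N2 "uncertainty principle for F_1", PROVED in general)
For a left-translation-invariant subspace `J ≤ ℂ^G` of a finite group and any `S ⊆ G`:
`|G| · dim {f ∈ J : supp f ⊆ S} ≤ |S| · dim J` (orthonormal bases of `ℂ^G`: the "leverage"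
`Σ_i |b_i(h)|²` of an orthonormal basis of `J` is basis-independent (Bessel), constant in `h`
(invariance) and sums to `dim J`).  For an `F_k`-separated triple the `|X||Z|` separators are
independent level-`k` functions supported off the GARBAGE `{x⁻¹yy'⁻¹z : y ≠ y'}`, whence
`|G|·|X||Z| ≤ |G ∖ garbage| · N_k`: the garbage misses at least the fraction `|X||Z|/N_k` of the
group — at `(2,1)` a fraction `≈ c²` (`|G|/N₁ ≈ p`), `p` times more than the det-twist near-isotropy
of ideator 2 gives. -/

namespace Moat


variable {G : Type} [Group G] [Fintype G] [DecidableEq G]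

/-- `ℂ^G` with its standard Hermitian structure. -/
abbrev Euc (G : Type) [Fintype G] : Type := EuclideanSpace ℂ G

/-- Left translation `(T g v)(x) = v(g⁻¹ x)` as a linear isometry of `ℂ^G`; `T g δ_h = δ_{gh}`. -/
def T (g : G) : Euc G ≃ₗᵢ[ℂ] Euc G :=
  LinearIsometryEquiv.piLpCongrLeft 2 ℂ ℂ (Equiv.mulLeft g)

theorem T_single (g h : G) (a : ℂ) :
    T g (EuclideanSpace.single h a) = EuclideanSpace.single (g * h) a := by
  unfold T EuclideanSpace.single
  rw [LinearIsometryEquiv.piLpCongrLeft_single]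
  rfl

omit [DecidableEq G] in
theorem T_apply (g : G) (v : Euc G) (x : G) : T g v x = v (g⁻¹ * x) := by
  simp [T, LinearIsometryEquiv.piLpCongrLeft_apply, Equiv.piCongrLeft', Equiv.mulLeft_symm_apply]

/-- The "leverage" of a finite orthonormal system at a vector: `Σ_i |⟪b_i, x⟫|²`. -/
def lev {ι : Type} [Fintype ι] (b : ι → Euc G) (x : Euc G) : ℝ := ∑ i, ‖⟪b i, x⟫_ℂ‖ ^ 2

omit [Group G] [DecidableEq G] in
/-- **Basis independence / Bessel.**  If `b` is an orthonormal basis of `K` (as a family in `ℂ^G`)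
and `v` is any finite orthonormal family inside `K`, then `Σ_j |⟪v_j, x⟫|² ≤ Σ_i |⟪b_i, x⟫|²`. -/
theorem lev_le_lev_of_orthonormal (K : Submodule ℂ (Euc G)) {ι : Type} [Fintype ι]
    (b : OrthonormalBasis ι ℂ K) {κ : Type} [Fintype κ] {v : κ → Euc G}
    (hv : Orthonormal ℂ v) (hvK : ∀ j, v j ∈ K) (x : Euc G) :
    lev v x ≤ lev (fun i => (b i : Euc G)) x := by
  classical
  -- w := Σ_i ⟪b_i, x⟫ b_i ∈ K, the orthogonal projection written in the basis b
  set w : K := ∑ i, ⟪(b i : Euc G), x⟫_ℂ • b i with hw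
  -- ⟪k, x⟫ = ⟪k, w⟫ for every k ∈ K
  have hkey : ∀ k : K, ⟪(k : Euc G), x⟫_ℂ = ⟪(k : Euc G), (w : Euc G)⟫_ℂ := by
    intro k
    -- expand k in the basis b
    have hk : (k : Euc G) = ∑ j, ⟪(b j : Euc G), (k : Euc G)⟫_ℂ • (b j : Euc G) := by
      have := b.sum_repr' k
      -- inner products in K are those of Euc G
      conv_lhs => rw [← this]
      simp [Submodule.coe_inner]
    have hbw : ∀ j, ⟪(b j : Euc G), (w : Euc G)⟫_ℂ = ⟪(b j : Euc G), x⟫_ℂ := by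
      intro j
      rw [hw]
      simp only [Submodule.coe_sum, Submodule.coe_smul, inner_sum, inner_smul_right]
      have horth : ∀ i, ⟪(b j : Euc G), (b i : Euc G)⟫_ℂ = if j = i then 1 else 0 := by
        intro i
        rw [← Submodule.coe_inner, orthonormal_iff_ite.mp b.orthonormal]
      simp_rw [horth]
      simp
    rw [hk]
    simp only [sum_inner, inner_smul_left, hbw]
  -- Bessel for the family v applied to w, and Parseval for w in the basis b
  have hB := hv.sum_inner_products_le (s := Finset.univ) (w : Euc G)
  have hP : ∑ i, ‖⟪(b i : Euc G), (w : Euc G)⟫_ℂ‖ ^ 2 = ‖(w : Euc G)‖ ^ 2 := by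
    have := b.sum_sq_norm_inner_right w
    simp only [Submodule.coe_norm] at this
    exact this
  unfold lev
  calc ∑ j, ‖⟪v j, x⟫_ℂ‖ ^ 2 = ∑ j, ‖⟪v j, (w : Euc G)⟫_ℂ‖ ^ 2 := by
        refine Finset.sum_congr rfl fun j _ => ?_
        rw [hkey ⟨v j, hvK j⟩]
    _ ≤ ‖(w : Euc G)‖ ^ 2 := hB
    _ = ∑ i, ‖⟪(b i : Euc G), (w : Euc G)⟫_ℂ‖ ^ 2 := hP.symm
    _ = ∑ i, ‖⟪(b i : Euc G), x⟫_ℂ‖ ^ 2 := by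
        refine Finset.sum_congr rfl fun i _ => ?_
        rw [hkey (b i)]

/-- Functions supported in `S`, as a subspace of `ℂ^G`. -/
def Supp (S : Finset G) : Submodule ℂ (Euc G) where
  carrier := {v | ∀ x, x ∉ S → v x = 0}
  zero_mem' := by intro x _; rfl
  add_mem' := by
    intro u v hu hv x hx
    simp [hu x hx, hv x hx]
  smul_mem' := by
    intro c v hv x hx
    simp [hv x hx]

omit [Group G] [DecidableEq G] in
theorem mem_Supp {S : Finset G} {v : Euc G} : v ∈ Supp S ↔ ∀ x, x ∉ S → v x = 0 := Iff.rfl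

omit [Group G] in
/-- `⟪v, δ_h⟫ = conj (v h)`, so `|⟪v, δ_h⟫| = |v h|`. -/
theorem norm_inner_single (v : Euc G) (h : G) :
    ‖⟪v, EuclideanSpace.single h (1 : ℂ)⟫_ℂ‖ = ‖v h‖ := by
  rw [EuclideanSpace.inner_single_right]
  simp

omit [Group G] in
/-- **Total leverage = dimension**: `Σ_h Σ_i |⟪b_i, δ_h⟫|² = #ι` for an orthonormal family `b`
(each `b_i` has `Σ_h |b_i(h)|² = ‖b_i‖² = 1`). -/
theorem sum_lev_single {ι : Type} [Fintype ι] {b : ι → Euc G} (hb : Orthonormal ℂ b) :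
    ∑ h, lev b (EuclideanSpace.single h 1) = Fintype.card ι := by
  unfold lev
  rw [Finset.sum_comm]
  have : ∀ i, ∑ h, ‖⟪b i, EuclideanSpace.single h (1 : ℂ)⟫_ℂ‖ ^ 2 = 1 := by
    intro i
    simp_rw [norm_inner_single]
    rw [← EuclideanSpace.norm_sq_eq, hb.norm_eq_one i, one_pow]
  simp [this]

omit [Group G] in
/-- **Supported subspaces are paid for by leverage**: if `b` is an orthonormal basis of `K`, then
`dim (K ⊓ Supp S) ≤ Σ_{h ∈ S} Σ_i |⟪b_i, δ_h⟫|²`. -/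
theorem finrank_inf_Supp_le_sum_lev (K : Submodule ℂ (Euc G)) {ι : Type} [Fintype ι]
    (b : OrthonormalBasis ι ℂ K) (S : Finset G) :
    (Module.finrank ℂ ↥(K ⊓ Supp S) : ℝ) ≤ ∑ h ∈ S, lev (fun i => (b i : Euc G)) (EuclideanSpace.single h 1) := by
  classical
  set V := K ⊓ Supp S
  let c := stdOrthonormalBasis ℂ V
  -- the basis of V as an orthonormal family in Euc G, inside K, supported in S
  have hc : Orthonormal ℂ (fun j => ((c j : V) : Euc G)) := by
    have := c.orthonormal
    rw [orthonormal_iff_ite] at this ⊢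
    intro i j
    rw [← Submodule.coe_inner]
    exact this i j
  have hcK : ∀ j, ((c j : V) : Euc G) ∈ K := fun j => (c j).2.1
  have hcS : ∀ j, ∀ x, x ∉ S → ((c j : V) : Euc G) x = 0 := fun j => (c j).2.2
  -- dim V = Σ_j ‖c_j‖² = Σ_j Σ_{h ∈ S} |c_j(h)|²
  have hdim : (Module.finrank ℂ V : ℝ) = ∑ j, ∑ h ∈ S, ‖⟪((c j : V) : Euc G), EuclideanSpace.single h (1 : ℂ)⟫_ℂ‖ ^ 2 := by
    have h1 : ∀ j, ∑ h ∈ S, ‖⟪((c j : V) : Euc G), EuclideanSpace.single h (1 : ℂ)⟫_ℂ‖ ^ 2 = 1 := by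
      intro j
      simp_rw [norm_inner_single]
      rw [Finset.sum_subset (f := fun x => ‖((c j : V) : Euc G) x‖ ^ 2) (Finset.subset_univ S)
          (fun h _ hS => by simp [hcS j h hS]),
        ← EuclideanSpace.norm_sq_eq, hc.norm_eq_one j, one_pow]
    simp [h1]
  rw [hdim, Finset.sum_comm]
  refine Finset.sum_le_sum fun h _ => ?_
  exact lev_le_lev_of_orthonormal K b hc hcK _

/-- **Invariance makes leverage constant**: if `K` is stable under all left translations `T g`, then
`Σ_i |⟪b_i, δ_{gh}⟫|² = Σ_i |⟪b_i, δ_h⟫|²` for an orthonormal basis `b` of `K`. -/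
theorem lev_single_mul (K : Submodule ℂ (Euc G)) (hK : ∀ g, ∀ v ∈ K, T g v ∈ K) {ι : Type}
    [Fintype ι] (b : OrthonormalBasis ι ℂ K) (g h : G) :
    lev (fun i => (b i : Euc G)) (EuclideanSpace.single (g * h) 1)
      = lev (fun i => (b i : Euc G)) (EuclideanSpace.single h 1) := by
  classical
  -- general fact: lev b (T g x) ≤ lev b x, because (T g)⁻¹ b is another orthonormal family in K
  have hle : ∀ (g : G) (x : Euc G), lev (fun i => (b i : Euc G)) (T g x)
      ≤ lev (fun i => (b i : Euc G)) x := by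
    intro g x
    have hv : Orthonormal ℂ (fun i => (T g).symm (b i : Euc G)) := by
      have hb : Orthonormal ℂ (fun i => (b i : Euc G)) := by
        have := b.orthonormal
        rw [orthonormal_iff_ite] at this ⊢
        intro i j; rw [← Submodule.coe_inner]; exact this i j
      exact hb.comp_linearIsometryEquiv (T g).symm
    have hvK : ∀ i, (T g).symm (b i : Euc G) ∈ K := by
      intro i
      have : (T g).symm = T g⁻¹ := by
        unfold T
        rw [LinearIsometryEquiv.piLpCongrLeft_symm]
        congr 1
        ext x; simp
      rw [this]
      exact hK g⁻¹ _ (b i).2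
    have h := lev_le_lev_of_orthonormal K b hv hvK x
    -- lev of the pulled-back family at x equals lev b at T g x
    have heq : lev (fun i => (T g).symm (b i : Euc G)) x = lev (fun i => (b i : Euc G)) (T g x) := by
      unfold lev
      refine Finset.sum_congr rfl fun i _ => ?_
      rw [LinearIsometryEquiv.inner_map_eq_flip, LinearIsometryEquiv.symm_symm]
    rwa [heq] at h
  apply le_antisymm
  · rw [← T_single g h 1]
    exact hle g _
  · have h1 : EuclideanSpace.single h (1 : ℂ) = T g⁻¹ (EuclideanSpace.single (g * h) 1) := by
      rw [T_single]; simp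
    rw [h1]
    exact hle g⁻¹ _

/-- **MOAT INEQUALITY (ideator 3's N2, Euclidean form).**  For a left-translation-invariant
subspace `K ≤ ℂ^G` and any `S ⊆ G`: `|G| · dim (K ⊓ Supp S) ≤ |S| · dim K`. -/
theorem card_mul_finrank_inf_Supp_le (K : Submodule ℂ (Euc G)) (hK : ∀ g, ∀ v ∈ K, T g v ∈ K)
    (S : Finset G) :
    Fintype.card G * Module.finrank ℂ ↥(K ⊓ Supp S) ≤ S.card * Module.finrank ℂ K := by
  classical
  let b := stdOrthonormalBasis ℂ K
  set L : ℝ := lev (fun i => (b i : Euc G)) (EuclideanSpace.single (1 : G) 1) with hL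
  have hconst : ∀ h, lev (fun i => (b i : Euc G)) (EuclideanSpace.single h 1) = L := by
    intro h
    have := lev_single_mul K hK b h 1
    rwa [mul_one] at this
  have hb : Orthonormal ℂ (fun i => (b i : Euc G)) := by
    have := b.orthonormal
    rw [orthonormal_iff_ite] at this ⊢
    intro i j; rw [← Submodule.coe_inner]; exact this i j
  -- |G| L = dim K
  have htot : (Fintype.card G : ℝ) * L = Module.finrank ℂ K := by
    have := sum_lev_single hb
    simp_rw [hconst] at this
    rw [Finset.sum_const, Finset.card_univ, nsmul_eq_mul] at this
    rw [this, Fintype.card_fin]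
  -- dim (K ⊓ Supp S) ≤ |S| L
  have hsub : (Module.finrank ℂ ↥(K ⊓ Supp S) : ℝ) ≤ S.card * L := by
    have := finrank_inf_Supp_le_sum_lev K b S
    simp_rw [hconst] at this
    rwa [Finset.sum_const, nsmul_eq_mul] at this
  have : (Fintype.card G : ℝ) * Module.finrank ℂ ↥(K ⊓ Supp S) ≤ S.card * Module.finrank ℂ K := by
    calc (Fintype.card G : ℝ) * Module.finrank ℂ ↥(K ⊓ Supp S)
        ≤ Fintype.card G * (S.card * L) := by gcongr
      _ = S.card * (Fintype.card G * L) := by ring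
      _ = S.card * Module.finrank ℂ K := by rw [htot]
  exact_mod_cast this

/-! ### Transport to plain functions `G → ℂ` -/

/-- Functions `G → ℂ` supported in `S`. -/
def SuppFun (S : Finset G) : Submodule ℂ (G → ℂ) where
  carrier := {f | ∀ x, x ∉ S → f x = 0}
  zero_mem' := by intro x _; rfl
  add_mem' := by
    intro u v hu hv x hx
    simp [hu x hx, hv x hx]
  smul_mem' := by
    intro c v hv x hx
    simp [hv x hx]

omit [Group G] [Fintype G] [DecidableEq G] in
theorem mem_SuppFun {S : Finset G} {f : G → ℂ} : f ∈ SuppFun S ↔ ∀ x, x ∉ S → f x = 0 := Iff.rfl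

/-- The identification `ℂ^G ≃ EuclideanSpace ℂ G` (as a linear equivalence). -/
def toEuc : (G → ℂ) ≃ₗ[ℂ] Euc G := (WithLp.linearEquiv 2 ℂ (G → ℂ)).symm

omit [Group G] [DecidableEq G] in
@[simp] theorem toEuc_apply (f : G → ℂ) (x : G) : toEuc f x = f x := rfl

/-- **MOAT INEQUALITY for left-invariant spaces of functions** (ideator 3's N2): if `J ≤ ℂ^G` is
stable under `f ↦ f(h·)` for every `h`, then `|G| · dim {f ∈ J : supp f ⊆ S} ≤ |S| · dim J`. -/
theorem card_mul_finrank_inf_SuppFun_le (J : Submodule ℂ (G → ℂ))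
    (hJ : ∀ f ∈ J, ∀ h : G, (fun x => f (h * x)) ∈ J) (S : Finset G) :
    Fintype.card G * Module.finrank ℂ ↥(J ⊓ SuppFun S) ≤ S.card * Module.finrank ℂ J := by
  classical
  set K : Submodule ℂ (Euc G) := J.map ((toEuc (G := G)).toLinearMap) with hKdef
  have hK : ∀ g, ∀ v ∈ K, T g v ∈ K := by
    intro g v hv
    rw [hKdef, Submodule.mem_map] at hv ⊢
    obtain ⟨f, hf, rfl⟩ := hv
    refine ⟨fun x => f (g⁻¹ * x), hJ f hf g⁻¹, ?_⟩
    ext x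
    rw [T_apply]
    rfl
  have h1 : Module.finrank ℂ K = Module.finrank ℂ J := by
    rw [hKdef]; exact LinearEquiv.finrank_map_eq toEuc J
  have h2 : Module.finrank ℂ ↥(K ⊓ Supp S) = Module.finrank ℂ ↥(J ⊓ SuppFun S) := by
    have : K ⊓ Supp S = (J ⊓ SuppFun S).map ((toEuc (G := G)).toLinearMap) := by
      rw [hKdef, Submodule.map_inf (toEuc (G := G)).toLinearMap toEuc.injective]
      congr 1
      ext v
      simp only [Submodule.mem_map, mem_Supp, mem_SuppFun]
      constructor
      · intro hv
        refine ⟨toEuc.symm v, fun x hx => ?_, by simp⟩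
        exact hv x hx
      · rintro ⟨f, hf, rfl⟩ x hx
        simpa using hf x hx
    rw [this]
    exact LinearEquiv.finrank_map_eq toEuc _
  have h := card_mul_finrank_inf_Supp_le K hK S
  rwa [h1, h2] at h

/-! ### The design corollary: the garbage of a separated triple misses `≥ |X||Z|·|G|/N_k` points -/

section Design

open Summit.MatrixMultiplication.MatrixMultiplication.Cruxes.LieRankDesigns.Disproof

variable {m k : ℕ} [Fact p.Prime]

/-- The GARBAGE of a triple: the non-target quadruple products `x⁻¹ y y'⁻¹ z`, `y ≠ y'`. -/
def garbage (X Y Z : Finset (GLm p m)) : Finset (GLm p m) :=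
  (((X ×ˢ Y) ×ˢ (Y ×ˢ Z)).filter fun q => q.1.2 ≠ q.2.1).image
    fun q => q.1.1⁻¹ * q.1.2 * q.2.1⁻¹ * q.2.2

theorem mem_garbage {X Y Z : Finset (GLm p m)} {x y y' z : GLm p m} (hx : x ∈ X) (hy : y ∈ Y)
    (hy' : y' ∈ Y) (hz : z ∈ Z) (hne : y ≠ y') : x⁻¹ * y * y'⁻¹ * z ∈ garbage X Y Z := by
  classical
  unfold garbage
  rw [Finset.mem_image]
  exact ⟨((x, y), (y', z)), by simp [hx, hy, hy', hz, hne], rfl⟩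

/-- Separators vanish on the garbage. -/
theorem sep_eq_zero_of_mem_garbage {X Y Z : Finset (GLm p m)} {x₀ z₀ : GLm p m}
    {c : Mat p m → ℂ}
    (hsepc : ∀ x ∈ X, ∀ y ∈ Y, ∀ y' ∈ Y, ∀ z ∈ Z,
      fourierFn c (x⁻¹ * y * y'⁻¹ * z) = if x = x₀ ∧ y = y' ∧ z = z₀ then 1 else 0)
    {g : GLm p m} (hg : g ∈ garbage X Y Z) : fourierFn c g = 0 := by
  classical
  unfold garbage at hg
  rw [Finset.mem_image] at hg
  obtain ⟨⟨⟨x, y⟩, ⟨y', z⟩⟩, hq, rfl⟩ := hg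
  simp only [Finset.mem_filter, Finset.mem_product] at hq
  rw [hsepc x hq.1.1.1 y hq.1.1.2 y' hq.1.2.1 z hq.1.2.2, if_neg]
  rintro ⟨-, h, -⟩
  exact hq.2 h

/-- **The separators span `≥ |X||Z|` dimensions of level-`k` functions supported OFF the garbage.** -/
theorem card_mul_card_le_finrank_inf_SuppFun {X Y Z : Finset (GLm p m)} (hsep : RankSep k X Y Z)
    (hY : Y.Nonempty) :
    X.card * Z.card ≤ Module.finrank ℂ
      ↥(levelSubmodule p m k ⊓ SuppFun (Finset.univ \ garbage X Y Z)) := by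
  classical
  obtain ⟨y₀, hy₀⟩ := hY
  set J := levelSubmodule p m k ⊓ SuppFun (Finset.univ \ garbage X Y Z)
  -- restriction to the targets x⁻¹ z
  let r : J →ₗ[ℂ] (↥(X ×ˢ Z) → ℂ) :=
    { toFun := fun f t => (f : GLm p m → ℂ) (t.1.1⁻¹ * t.1.2)
      map_add' := fun f f' => by funext t; rfl
      map_smul' := fun a f => by funext t; rfl }
  have hsurj : Function.Surjective r := by
    rw [← LinearMap.range_eq_top, eq_top_iff, ← (Pi.basisFun ℂ _).span_eq, Submodule.span_le]
    rintro _ ⟨⟨⟨x₀, z₀⟩, ht₀⟩, rfl⟩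
    rw [Finset.mem_product] at ht₀
    obtain ⟨c, hc, hsepc⟩ := hsep x₀ ht₀.1 z₀ ht₀.2
    have hfJ : fourierFn c ∈ J := by
      refine ⟨mem_levelSubmodule_iff.mpr ⟨c, hc, fun g => rfl⟩, fun g hg => ?_⟩
      rw [Finset.mem_sdiff, not_and_or, not_not] at hg
      rcases hg with hg | hg
      · exact absurd (Finset.mem_univ g) hg
      · exact sep_eq_zero_of_mem_garbage hsepc hg
    refine ⟨⟨fourierFn c, hfJ⟩, ?_⟩
    funext t
    obtain ⟨⟨x, z⟩, ht⟩ := t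
    rw [Finset.mem_product] at ht
    simp only [r, LinearMap.coe_mk, AddHom.coe_mk, Pi.basisFun_apply]
    rw [show x⁻¹ * z = x⁻¹ * y₀ * y₀⁻¹ * z by group, hsepc x ht.1 y₀ hy₀ y₀ hy₀ z ht.2,
      Pi.single_apply]
    congr 1
    simp only [true_and, Subtype.mk.injEq, Prod.mk.injEq]
  have h := LinearMap.finrank_le_finrank_of_surjective hsurj
  rwa [Module.finrank_fintype_fun_eq_card, Fintype.card_coe, Finset.card_product] at h

/-- **MOAT INEQUALITY FOR GRADED DESIGNS** (ideator 3's N2, proved): for every `F_k`-separated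
triple in `GL_m(𝔽_p)` with `Y ≠ ∅`,
`|GL_m(𝔽_p)| · |X| · |Z| ≤ |GL_m(𝔽_p) ∖ garbage| · N_k`, i.e. the garbage `{x⁻¹yy'⁻¹z : y ≠ y'}`
misses at least the fraction `|X||Z|/N_k` of the group (`≈ c²` for the crux at `(2,1)`, where
`|G|/N₁ ≈ p`: the garbage of a witness misses `≳ c²p⁴` elements although it is a union of
`|Y|(|Y|−1) ≈ c²p³` translated copies of sets of size `≥ c p^{3/2}`). -/
theorem moat {X Y Z : Finset (GLm p m)} (hsep : RankSep k X Y Z) (hY : Y.Nonempty) :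
    Fintype.card (GLm p m) * (X.card * Z.card)
      ≤ (Finset.univ \ garbage X Y Z).card * Fintype.card (RankLE p m k) := by
  classical
  have h1 := card_mul_card_le_finrank_inf_SuppFun hsep hY
  have h2 := card_mul_finrank_inf_SuppFun_le (levelSubmodule p m k)
    (fun f hf h => levelSubmodule_left_inv f hf h) (Finset.univ \ garbage X Y Z)
  have h3 : (Finset.univ \ garbage X Y Z).card * Module.finrank ℂ ↥(levelSubmodule p m k)
      ≤ (Finset.univ \ garbage X Y Z).card * Fintype.card (RankLE p m k) :=
    Nat.mul_le_mul_left _ finrank_levelSubmodule_le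
  calc Fintype.card (GLm p m) * (X.card * Z.card)
      ≤ Fintype.card (GLm p m) * Module.finrank ℂ
          ↥(levelSubmodule p m k ⊓ SuppFun (Finset.univ \ garbage X Y Z)) :=
        Nat.mul_le_mul_left _ h1
    _ ≤ _ := h2.trans h3

end Design


end Moat

/-- **Moat inequality at `(2,1)` with explicit numbers**: for every rank-1-separated triple of
`GL_2(𝔽_p)` with `Y ≠ ∅`, `(p²−1)(p²−p)·|X|·|Z| ≤ |GL_2(𝔽_p) ∖ garbage| · (p³+p²−p)`; for a crux
witness (`|X||Z| ≥ c²p³`) the garbage misses `≥ (c² − o(1))·|GL_2(𝔽_p)|` elements. -/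
theorem moat_levelOne [Fact p.Prime] {X Y Z : Finset (GLm p 2)} (hsep : RankSep 1 X Y Z)
    (hY : Y.Nonempty) :
    (p ^ 2 - 1) * (p ^ 2 - p) * (X.card * Z.card)
      ≤ (Finset.univ \ Moat.garbage X Y Z).card * (p ^ 3 + p ^ 2 - p) := by
  rw [← card_GL2, ← card_rankLE_two_one]
  exact Moat.moat hsep hY

/-! ## NearMisses
None recorded as `sorry`d theorems this cycle: the only statement that would close the crux
negatively is `LevelOnePackingBound C` for some `C` (or the eventual emptiness of the `(2,1)`
exponent-3 cell), and neither has a proof strategy beyond the heuristics in the header. -/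

end Summit.MatrixMultiplication.MatrixMultiplication.Cruxes.LevelOneGL2Designs.Disproof

end
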